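import Literature.Computability.Cryptography.ShorAssembly
import Literature.Computability.Complexity.StackStrings
import Literature.Computability.Complexity.StackModArith
import Literature.Computability.Complexity.BinarySubtraction
import HarnessLib

/-!
# The post-processor of Shor's order finding is polynomial time: `ordPost_mem_FP` discharged

`ShorAssembly.lean` reduces `factoring_mem_FBQP` (Shor's theorem in `FBQP` form) to six named
facts, one of which is the programming fact `ordPost_mem_FP : ordPost ∈ FP` — the classical
post-processor of an order query `⟨w, y⟩`, `w = ⟨⟨bin x, bin n⟩, bin i⟩`: check that `w` is a
canonical query with `1 < n`, scan the prefixes of the measured string `y` for the first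
candidate `c` with `x ^ c ≡ 1 (mod n)` (`orderFromPrefix`), and output bit `i` of it. This file
**proves** that fact (`ordPost_mem_FP_holds`) by programming the post-processor as a structured
stack program (`StackPrograms.lean`: `Com`, `Runs`, `Com.mem_FP`) over the register file
`OrdPost.K ⊕ AReg` and verifying it:

* pure layer: `decodeNat` of an arbitrary string via `bitsToNat` and the canonical completion
  `canonBits` (`bitsToNat_canonBits`), the left-to-right `scan` with `orderFromPrefix_eq_scan`,
  and `ordPost_eq` — `ordPost` restated over the parsed components and the validity bit `valid`
  (`valid_iff`: well-formed pairs `wellPaired`, canonical numerals, `|bin n| ≥ 2`);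
* `OrdPost.parse` (three pair decoders `unpairW`, `peekCanon`, `peekTwo`, `andFlag` of
  `StackStrings.lean`; `runs_parse`, linear time);
* `OrdPost.kernel`: reduce `x` modulo `n` by `modMul` and, for each bit of `y`, one round
  `OrdPost.mbody` — extend the prefix, build the exponent, `modExp` (`StackModArith.lean`,
  CLRS's MODULAR-EXPONENTIATION), test `x = 1` (`peekOne`), and on the first admissible candidate
  `OrdPost.record` it and read bit `i` by a counter walk `OrdPost.bitAt` (bank `sub`);
  `runs_mbody`, `runs_mloop` (loop invariant: the scan state `fnd` latched in the registers
  `FOUND`/`DONE`/`OUT`, `kfile`), `runs_kernel`, `runs_prog`;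
* the step bound `costPoly` (degree 4 in `|z|`) and `ordPost_mem_FP_holds`.

## References

* P. W. Shor, *Polynomial-time algorithms for prime factorization and discrete logarithms on a
  quantum computer*, SIAM J. Comput. 26 (1997) 1484–1509, §5 (the classical post-processing of
  order finding is polynomial time).
* T. H. Cormen, C. E. Leiserson, R. L. Rivest, C. Stein, *Introduction to Algorithms*, MIT Press,
  §31.6 (MODULAR-EXPONENTIATION; used through `StackModArith.lean`).
* S. Arora, B. Barak, *Computational Complexity: A Modern Approach*, CUP 2009, §0.1 (pairing),
  §1.3 (polynomial time, robustness).
* T. Nipkow, G. Klein, *Concrete Semantics with Isabelle/HOL*, Springer 2014, Ch. 7 (big-step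
  reasoning), for the verification style.
-/

namespace Literature.Computability.Cryptography

open _root_.Computability Complexity

/-! ### `decodeNat` of an arbitrary string, via `bitsToNat` -/

/-- Mathlib's `decodePosNum` on an arbitrary string: the binary value, plus a leading `1` at
position `|l|` unless the string already ends in `true`. [folklore] -/
theorem decodePosNum_eq (l : List Bool) :
    ((decodePosNum l : PosNum) : ℕ) =
      if l.getLast? = some true then bitsToNat l else bitsToNat l + 2 ^ l.length := by
  induction l with
  | nil => simp [decodePosNum]
  | cons b l ih =>
    cases b with
    | false =>
      rw [decodePosNum, PosNum.cast_bit0, ih]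
      cases l with
      | nil => simp
      | cons b' l' =>
        rw [List.getLast?_cons_cons]
        split_ifs <;> simp [pow_succ] <;> ring
    | true =>
      rw [decodePosNum]
      cases l with
      | nil => simp
      | cons b' l' =>
        rw [if_neg (List.cons_ne_nil _ _), PosNum.cast_bit1, ih, List.getLast?_cons_cons]
        split_ifs <;> simp [pow_succ] <;> ring

/-- Mathlib's `decodeNat` on an arbitrary string. [folklore] -/
theorem decodeNat_eq (l : List Bool) :
    decodeNat l =
      if l = [] then 0 else if l.getLast? = some true then bitsToNat l else bitsToNat l + 2 ^ l.length := by
  unfold decodeNat decodeNum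
  by_cases h : l = []
  · simp [h]
  · simp [h, decodePosNum_eq]

/-- The canonical numeral with the value `decodeNat l`: append the leading `1` that the decoder
reads into a string ending in `false`. [folklore] -/
def canonBits (l : List Bool) : List Bool :=
  if l.getLast? = some false then l ++ [true] else l

/-- `canonBits` appends a `true` after a final `false`. [folklore] -/
theorem canonBits_append_false (l : List Bool) : canonBits (l ++ [false]) = l ++ [false] ++ [true] := by
  simp [canonBits]

/-- `canonBits` keeps a string ending in `true`. [folklore] -/
theorem canonBits_append_true (l : List Bool) : canonBits (l ++ [true]) = l ++ [true] := by
  simp [canonBits]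

/-- `canonBits` of the empty string. [folklore] -/
@[simp] theorem canonBits_nil : canonBits [] = [] := by simp [canonBits]

/-- **`decodeNat` is `bitsToNat` of the canonical completion.** [folklore] -/
theorem bitsToNat_canonBits (l : List Bool) : bitsToNat (canonBits l) = decodeNat l := by
  rw [decodeNat_eq]
  by_cases hl : l = []
  · subst hl; simp
  · rw [if_neg hl, canonBits]
    have : l.getLast? = some false ∨ l.getLast? = some true := by
      obtain ⟨b, hb⟩ := Option.isSome_iff_exists.1 (List.getLast?_isSome.2 hl)
      cases b <;> simp [hb]
    rcases this with h | h
    · simp [h, bitsToNat_append]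
    · simp [h]

/-- `canonBits l` is a canonical numeral. [folklore] -/
theorem isCanonicalNum_canonBits (l : List Bool) : IsCanonicalNum (canonBits l) := by
  unfold canonBits IsCanonicalNum
  split_ifs with h
  · exact Or.inr (by simp)
  · cases hl : l.getLast? with
    | none => exact Or.inl (List.getLast?_eq_none_iff.1 hl)
    | some b =>
      cases b with
      | true => exact Or.inr rfl
      | false => exact absurd hl h

/-- A canonical numeral is its own completion. [folklore] -/
theorem canonBits_eq_self {l : List Bool} (h : IsCanonicalNum l) : canonBits l = l := by
  unfold canonBits
  rcases h with rfl | h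
  · simp
  · simp [h]

/-- `encodeNat (decodeNat l) = canonBits l`. [folklore] -/
theorem encodeNat_decodeNat_eq_canonBits (l : List Bool) : encodeNat (decodeNat l) = canonBits l := by
  rw [← bitsToNat_canonBits, encodeNat_bitsToNat (isCanonicalNum_canonBits l)]

/-- On canonical numerals `decodeNat = bitsToNat`. [folklore] -/
theorem decodeNat_eq_bitsToNat {l : List Bool} (h : IsCanonicalNum l) : decodeNat l = bitsToNat l := by
  rw [← bitsToNat_canonBits, canonBits_eq_self h]

/-- A nonempty string decodes to a positive number. [folklore] -/
theorem decodeNat_pos {l : List Bool} (hl : l ≠ []) : 0 < decodeNat l := by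
  rw [decodeNat_eq, if_neg hl]
  split_ifs with h
  · obtain ⟨l', rfl⟩ := List.getLast?_eq_some_iff.1 h
    simp [bitsToNat_append]
  · positivity

/-- The value of a string has bit `i` at entry `i`. [folklore] -/
theorem testBit_bitsToNat (l : List Bool) (i : ℕ) : (bitsToNat l).testBit i = l.getD i false := by
  induction l generalizing i with
  | nil => simp
  | cons b l ih =>
    have hval : bitsToNat (b :: l) = Nat.bit b (bitsToNat l) := by
      rw [bitsToNat_cons, Nat.bit_val]; ring
    cases i with
    | zero => rw [hval, Nat.testBit_bit_zero]; simp
    | succ i => rw [hval, Nat.testBit_bit_succ, ih]; simp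

/-- A canonical numeral is `> 1` iff it has at least two bits. [folklore] -/
theorem one_lt_bitsToNat_iff {l : List Bool} (h : IsCanonicalNum l) : 1 < bitsToNat l ↔ 2 ≤ l.length := by
  rcases h with rfl | h
  · simp
  · obtain ⟨v, rfl⟩ := List.getLast?_eq_some_iff.1 h
    rw [bitsToNat_append, List.length_append, List.length_singleton]
    have hv := bitsToNat_lt v
    rcases v with _ | ⟨b, v⟩
    · simp
    · simp only [List.length_cons, bitsToNat_cons] at hv ⊢
      constructor
      · intro; omega
      · intro
        have : 2 ≤ 2 ^ (v.length + 1) := by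
          calc (2 : ℕ) = 2 ^ 1 := by norm_num
            _ ≤ 2 ^ (v.length + 1) := Nat.pow_le_pow_right (by norm_num) (by omega)
        simp; omega

/-! ### Sizes of the components of a pair -/

/-- The components of `boolUnpair z` are together not longer than `z` (the first component alone:
`Literature.Computability.Complexity.length_boolUnpair_fst_le`, `NondeterministicProofs.lean`). [folklore] -/
theorem length_boolUnpair_le : ∀ z : List Bool,
    (boolUnpair z).1.length + (boolUnpair z).2.length ≤ z.length
  | [] => by simp [boolUnpair]
  | [b] => by simp [boolUnpair_singleton]
  | b :: b' :: rest => by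
    rw [boolUnpair_cons_cons]
    have ih := length_boolUnpair_le rest
    split_ifs <;> simp <;> omega

/-- The second component is not longer than the pair. [folklore] -/
theorem length_boolUnpair_snd_le (z : List Bool) : (boolUnpair z).2.length ≤ z.length :=
  le_trans (Nat.le_add_left _ _) (length_boolUnpair_le z)

/-! ### The scan for the first admissible prefix -/

/-- Admissibility of a prefix as an order candidate: positive value `c` with
`x ^ c ≡ 1 (mod n)`. [folklore] -/
def candOK (x n : ℕ) (l : List Bool) : Bool :=
  decide (0 < decodeNat l ∧ x ^ decodeNat l ≡ 1 [MOD n])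

/-- The left-to-right scan of `orderFromPrefix`: read the bits of `y`, extending the prefix,
and latch the canonical numeral of the first admissible prefix. [folklore] -/
def scan (x n : ℕ) : List Bool → List Bool → Option (List Bool) → Option (List Bool)
  | _, [], fnd => fnd
  | pre, b :: rest, fnd =>
    scan x n (pre ++ [b]) rest
      (match fnd with
        | some c => some c
        | none => if candOK x n (pre ++ [b]) then some (canonBits (pre ++ [b])) else none)

/-- The nonempty prefixes of `pre ++ rest` extending `pre`, by increasing length. [folklore] -/
def prefixesFrom : List Bool → List Bool → List (List Bool)
  | _, [] => []
  | pre, b :: rest => (pre ++ [b]) :: prefixesFrom (pre ++ [b]) rest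

/-- The scan is a `find?` over the prefixes. [folklore] -/
theorem scan_eq (x n : ℕ) : ∀ (pre rest : List Bool) (fnd : Option (List Bool)),
    scan x n pre rest fnd =
      (match fnd with
        | some c => some c
        | none => ((prefixesFrom pre rest).find? (candOK x n)).map canonBits)
  | pre, [], fnd => by cases fnd <;> rfl
  | pre, b :: rest, fnd => by
    simp only [scan, scan_eq x n (pre ++ [b]) rest]
    cases fnd with
    | some c => rfl
    | none =>
      simp only [prefixesFrom, List.find?_cons]
      cases candOK x n (pre ++ [b]) <;> rfl

/-- A latched candidate stays. [folklore] -/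
theorem scan_some (x n : ℕ) (pre rest : List Bool) (c : List Bool) :
    scan x n pre rest (some c) = some c := by
  rw [scan_eq]

/-- The prefixes by `take`. [folklore] -/
theorem map_take_range_eq_prefixesFrom (pre rest : List Bool) :
    (List.range rest.length).map (fun ℓ => pre ++ rest.take (ℓ + 1)) = prefixesFrom pre rest := by
  induction rest generalizing pre with
  | nil => rfl
  | cons b rest ih =>
    rw [List.length_cons, List.range_succ_eq_map, List.map_cons, List.map_map, prefixesFrom,
      ← ih (pre ++ [b])]
    congr 1
    refine List.map_congr_left fun ℓ _ => ?_
    simp [Function.comp, List.append_assoc]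

/-- **`orderFromPrefix` is computed by the scan**: the value of the latched numeral (or `0`).
[folklore] -/
theorem orderFromPrefix_eq_scan (x n : ℕ) (y : List Bool) :
    orderFromPrefix x n y = ((scan x n [] y none).map bitsToNat).getD 0 := by
  rw [scan_eq, orderFromPrefix, List.range_succ_eq_map, List.map_cons, List.find?_cons]
  have h0 : decide (0 < decodeNat (y.take 0) ∧ x ^ decodeNat (y.take 0) ≡ 1 [MOD n]) = false := by
    simp [decodeNat_eq]
  simp only [h0, List.map_map]
  have hp : (List.range y.length).map ((fun ℓ => decodeNat (y.take ℓ)) ∘ Nat.succ) =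
      (prefixesFrom [] y).map decodeNat := by
    rw [← map_take_range_eq_prefixesFrom, List.map_map]
    exact List.map_congr_left fun ℓ _ => by simp
  rw [hp, List.find?_map, Option.map_map]
  have hc : ((fun c => decide (0 < c ∧ x ^ c ≡ 1 [MOD n])) ∘ decodeNat) = candOK x n := by
    funext l; rfl
  rw [hc]
  cases (prefixesFrom [] y).find? (candOK x n) with
  | none => rfl
  | some l => simp [bitsToNat_canonBits]


/-! ### Registers and register files of the program -/

namespace OrdPost

open Complexity.Com Complexity.AReg

/-- The outer registers of the `ordPost` program (next to the arithmetic bank `AReg`):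
parsing (`inp … p3`, `fl`), the operands `I` (bit index), `Y` (unread bits of `y`),
`XB` (base reduced modulo `n`), and the kernel's `M` (multiplier), `P` (reversed prefix),
`E` (exponent), `NS` (saved modulus), `TC`, `CAND` (candidate numeral), `OUT` (output bit),
`FOUND`, `DONE` (latches). [folklore] -/
inductive K where
  | inp | a1 | t1 | m1 | p1 | w | a2 | t2 | m2 | p2 | ab | a3 | t3 | m3 | p3 | fl
  | I | Y | XB | M | P | E | NS | TC | CAND | OUT | FOUND | DONE
  deriving DecidableEq, Fintype

/-- All registers: outer registers and the arithmetic bank. [folklore] -/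
abbrev R := K ⊕ AReg

/-- An outer register file given by an association list (later entries shadowed; absent
registers empty). [folklore] -/
def mk (l : List (K × List Bool)) : Regs K := fun r => (l.lookup r).getD []

/-- Writing into an association-list file prepends. [folklore] -/
theorem update_mk (l : List (K × List Bool)) (k : K) (v : List Bool) :
    Function.update (mk l) k v = mk ((k, v) :: l) := by
  funext r
  by_cases h : r = k
  · subst h; simp [mk, List.lookup]
  · rw [Function.update_of_ne h]
    have hb : (r == k) = false := beq_false_of_ne h
    simp [mk, List.lookup, hb]

/-- Reading the empty file. [folklore] -/
@[simp] theorem mk_nil (r : K) : mk [] r = [] := rfl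

/-- Reading past one entry. [folklore] -/
theorem mk_cons (k : K) (v : List Bool) (l : List (K × List Bool)) (r : K) :
    mk ((k, v) :: l) r = if r = k then v else mk l r := by
  by_cases h : r = k
  · subst h; simp [mk, List.lookup]
  · have hb : (r == k) = false := beq_false_of_ne h
    simp [mk, List.lookup, hb, h]

/-- The initial register file of the program. [folklore] -/
theorem init_eq (z : List Bool) :
    Regs.init (Sum.inl K.inp : R) z = Sum.elim (mk [(K.inp, z)]) (file [] [] [] [] [] [] [] []) := by
  funext r
  rcases r with r | r
  · by_cases h : r = K.inp
    · subst h; rfl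
    · have hb : (r == K.inp) = false := beq_false_of_ne h
      simp [Regs.init, h, mk, List.lookup, hb]
  · cases r <;> rfl

/-! ### A constant-time test for the numeral `1` -/

section PeekOne

variable {ι : Type} [DecidableEq ι]

/-- `peekOne a F`: set the flag `F` to "register `a` holds exactly `[true]`" (the normal form of
`1`), peeking at the top two bits of `a` and restoring them. [folklore] -/
def peekOne (a F : ι) : Com ι :=
  clear F ;;
  pop a (pop a (Com.push a true ;; Com.push a true) (Com.push a false ;; Com.push a true)
      (Com.push a true ;; Com.push F true))
    (Com.push a false) skip

/-- `peekOne` decides `a = [true]` in `9` steps. [folklore] -/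
theorem runs_peekOne {a F : ι} (haF : a ≠ F) (Rg : Regs ι) (hF : (Rg F).length ≤ 1) :
    Runs (peekOne a F) Rg (Function.update Rg F (flag (decide (Rg a = [true])))) 9 := by
  have h1 := runs_clear_flag F hF
  set R₁ := Function.update Rg F [] with hR₁
  have hR₁a : R₁ a = Rg a := by simp [hR₁, haF]
  have h2 : Runs (pop a (pop a (Com.push a true ;; Com.push a true) (Com.push a false ;; Com.push a true)
      (Com.push a true ;; Com.push F true)) (Com.push a false) skip) R₁
      (Function.update Rg F (flag (decide (Rg a = [true])))) 6 := by
    obtain ⟨l, hRa⟩ : ∃ l, Rg a = l := ⟨_, rfl⟩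
    have hback : ∀ (b : Bool) (w : List Bool), Rg a = b :: w →
        Function.update (Function.update R₁ a w) a (b :: Function.update R₁ a w a) =
          Function.update Rg F [] := by
      intro b w h
      rw [Function.update_self, Function.update_idem, ← h, ← hR₁a, Function.update_eq_self]
    rcases l with _ | ⟨b, w⟩
    · refine (Runs.pop_nil _ _ (by rw [hR₁a, hRa]) (Runs.skip _)).of_eq ?_ (by omega)
      rw [hRa, hR₁]; simp
    · have hk : R₁ a = b :: w := by rw [hR₁a, hRa]
      cases b
      · refine (Runs.pop_false _ _ hk (Runs.push' (hback false w hRa))).of_eq ?_ (by omega)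
        rw [hRa]; simp
      · rcases w with _ | ⟨b', w⟩
        · have hnil : Function.update R₁ a ([] : List Bool) a = [] := by simp
          have hin : Runs _ (Function.update R₁ a []) _ 2 :=
            (Runs.push' (hback true [] hRa)).seq
              (Runs.push' (R := Function.update Rg F []) (k := F) (b := true) rfl)
          refine (Runs.pop_true _ _ hk (Runs.pop_nil _ _ hnil hin)).of_eq ?_ (by omega)
          rw [hRa]; simp
        · have hk' : Function.update R₁ a (b' :: w) a = b' :: w := by simp
          have hfin : ∀ c : Bool, Rg a = true :: c :: w →
              Runs (Com.push a c ;; Com.push a true) (Function.update (Function.update R₁ a (c :: w)) a w)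
                (Function.update Rg F []) 2 := by
            intro c h
            refine ((Runs.push' rfl).seq (Runs.push' ?_)).of_eq rfl (by omega)
            rw [Function.update_idem, Function.update_self, Function.update_idem, Function.update_self,
              Function.update_idem, ← h, ← hR₁a, Function.update_eq_self]
          cases b'
          · have hin : Runs _ (Function.update R₁ a (false :: w)) _ 4 :=
              Runs.pop_false (Com.push a true ;; Com.push a true) (Com.push a true ;; Com.push F true) hk'
                (hfin false hRa)
            refine (Runs.pop_true _ _ hk hin).of_eq ?_ (by omega)
            rw [hRa]; simp
          · have hin : Runs _ (Function.update R₁ a (true :: w)) _ 4 :=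
              Runs.pop_true (Com.push a false ;; Com.push a true) (Com.push a true ;; Com.push F true) hk'
                (hfin true hRa)
            refine (Runs.pop_true _ _ hk hin).of_eq ?_ (by omega)
            rw [hRa]; simp
  exact (h1.seq h2).mono (by omega)

end PeekOne

/-! ### Parsing the query -/

/-- The parsing stage: split `⟨w, y⟩`, then `w = ⟨ab, c⟩`, then `ab = ⟨a, b⟩` (each component
left *reversed* by `unpairW`, re-reversed by `pour` where it is parsed again), and accumulate
into `m2` the validity bit: `w` and `ab` well formed, `a`, `b`, `c` canonical numerals, `b` of
at least two bits. [folklore] -/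
def parse : Com R :=
  unpairW (.inl .inp) (.inl .a1) (.inl .t1) (.inl .m1) (.inl .p1) ;;
  (pour (.inl .a1) (.inl .w) ;;
  (unpairW (.inl .w) (.inl .a2) (.inl .t2) (.inl .m2) (.inl .p2) ;;
  (pour (.inl .a2) (.inl .ab) ;;
  (unpairW (.inl .ab) (.inl .a3) (.inl .t3) (.inl .m3) (.inl .p3) ;;
  (peekCanon (.inl .a3) (.inl .fl) ;; (andFlag (.inl .m2) (.inl .fl) ;;
  (peekCanon (.inl .t3) (.inl .fl) ;; (andFlag (.inl .m2) (.inl .fl) ;;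
  (peekCanon (.inl .t2) (.inl .fl) ;; (andFlag (.inl .m2) (.inl .fl) ;;
  (peekTwo (.inl .t3) (.inl .fl) ;; (andFlag (.inl .m2) (.inl .fl) ;;
  andFlag (.inl .m2) (.inl .m3)))))))))))))

/-- The first component of the query pair. [folklore] -/
abbrev qw (z : List Bool) : List Bool := (boolUnpair z).1
/-- The measured string. [folklore] -/
abbrev qy (z : List Bool) : List Bool := (boolUnpair z).2
/-- The pair `⟨a, b⟩` inside the query. [folklore] -/
abbrev qab (z : List Bool) : List Bool := (boolUnpair (qw z)).1
/-- The numeral of the bit index `i`. [folklore] -/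
abbrev qc (z : List Bool) : List Bool := (boolUnpair (qw z)).2
/-- The numeral of `x`. [folklore] -/
abbrev qa (z : List Bool) : List Bool := (boolUnpair (qab z)).1
/-- The numeral of `n`. [folklore] -/
abbrev qb (z : List Bool) : List Bool := (boolUnpair (qab z)).2

/-- The validity bit computed by `parse`: `w` and `ab` well formed, `a`, `b`, `c` canonical,
`b` of at least two bits. [folklore] -/
def valid (z : List Bool) : Bool :=
  (((((wellPaired (qw z) && canonTop (qa z).reverse) && canonTop (qb z).reverse) && canonTop (qc z).reverse) && decide (2 ≤ (qb z).length)) && wellPaired (qab z))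

/-- The empty bank. [folklore] -/
abbrev bank0 : Regs AReg := file [] [] [] [] [] [] [] []

/-! The successive outer register files of `parse` (association lists, newest writes first). -/

/-- Stage 0 of `parse`: the input. [folklore] -/
def st0 (z : List Bool) : List (K × List Bool) := [(.inp, z)]

/-- Stage 1 of `parse`. [folklore] -/
def st1 (z : List Bool) : List (K × List Bool) :=
  (.p1, []) :: (.m1, flag (wellPaired z)) :: (.t1, (qy z).reverse) :: (.a1, (qw z).reverse) :: (.inp, []) :: st0 z

/-- Stage 2 of `parse`. [folklore] -/
def st2 (z : List Bool) : List (K × List Bool) :=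
  (.w, qw z) :: (.a1, []) :: st1 z

/-- Stage 3 of `parse`. [folklore] -/
def st3 (z : List Bool) : List (K × List Bool) :=
  (.p2, []) :: (.m2, flag (wellPaired (qw z))) :: (.t2, (qc z).reverse) :: (.a2, (qab z).reverse) :: (.w, []) :: st2 z

/-- Stage 4 of `parse`. [folklore] -/
def st4 (z : List Bool) : List (K × List Bool) :=
  (.ab, qab z) :: (.a2, []) :: st3 z

/-- Stage 5 of `parse`. [folklore] -/
def st5 (z : List Bool) : List (K × List Bool) :=
  (.p3, []) :: (.m3, flag (wellPaired (qab z))) :: (.t3, (qb z).reverse) :: (.a3, (qa z).reverse) :: (.ab, []) :: st4 z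

/-- Stage 6 of `parse`. [folklore] -/
def st6 (z : List Bool) : List (K × List Bool) :=
  (.fl, flag (canonTop (qa z).reverse)) :: st5 z

/-- Stage 7 of `parse`. [folklore] -/
def st7 (z : List Bool) : List (K × List Bool) :=
  (.m2, flag (wellPaired (qw z) && canonTop (qa z).reverse)) :: st6 z

/-- Stage 8 of `parse`. [folklore] -/
def st8 (z : List Bool) : List (K × List Bool) :=
  (.fl, flag (canonTop (qb z).reverse)) :: st7 z

/-- Stage 9 of `parse`. [folklore] -/
def st9 (z : List Bool) : List (K × List Bool) :=
  (.m2, flag ((wellPaired (qw z) && canonTop (qa z).reverse) && canonTop (qb z).reverse)) :: st8 z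

/-- Stage 10 of `parse`. [folklore] -/
def st10 (z : List Bool) : List (K × List Bool) :=
  (.fl, flag (canonTop (qc z).reverse)) :: st9 z

/-- Stage 11 of `parse`. [folklore] -/
def st11 (z : List Bool) : List (K × List Bool) :=
  (.m2, flag (((wellPaired (qw z) && canonTop (qa z).reverse) && canonTop (qb z).reverse) && canonTop (qc z).reverse)) :: st10 z

/-- Stage 12 of `parse`. [folklore] -/
def st12 (z : List Bool) : List (K × List Bool) :=
  (.fl, flag (decide (2 ≤ (qb z).length))) :: st11 z

/-- Stage 13 of `parse`. [folklore] -/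
def st13 (z : List Bool) : List (K × List Bool) :=
  (.m2, flag ((((wellPaired (qw z) && canonTop (qa z).reverse) && canonTop (qb z).reverse) && canonTop (qc z).reverse) && decide (2 ≤ (qb z).length))) :: st12 z

/-- Stage 14 of `parse`. [folklore] -/
def st14 (z : List Bool) : List (K × List Bool) :=
  (.m2, flag (((((wellPaired (qw z) && canonTop (qa z).reverse) && canonTop (qb z).reverse) && canonTop (qc z).reverse) && decide (2 ≤ (qb z).length)) && wellPaired (qab z))) :: st13 z

/-- The outer register file after `parse`. [folklore] -/
abbrev parsed (z : List Bool) : List (K × List Bool) := st14 z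

attribute [local simp] st0 st1 st2 st3 st4 st5 st6 st7 st8 st9 st10 st11 st12 st13 st14 update_mk mk_cons

/-- **Simulation of `parse`**, in `27|z| + 84` steps. [folklore] -/
theorem runs_parse (z : List Bool) :
    Runs parse (Sum.elim (mk (st0 z)) bank0) (Sum.elim (mk (parsed z)) bank0) (27 * z.length + 84) := by
  have hw : (qw z).length ≤ z.length := length_boolUnpair_fst_le z
  have hab : (qab z).length ≤ (qw z).length := length_boolUnpair_fst_le (qw z)
  have h1 : Runs _ (Sum.elim (mk (st0 z)) bank0 : Regs R) (Sum.elim (mk (st1 z)) bank0) _ :=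
    (runs_unpairW (k := (.inl .inp : R)) (a := .inl .a1) (t := .inl .t1) (M := .inl .m1) (P := .inl .p1)
    (by decide) (Sum.elim (mk (st0 z)) bank0) rfl rfl).of_eq
      (by simp [-Sum.elim_update_left, -Sum.elim_update_right]) le_rfl
  have h2 : Runs _ (Sum.elim (mk (st1 z)) bank0 : Regs R) (Sum.elim (mk (st2 z)) bank0) _ :=
    (runs_pour (a := (.inl .a1 : R)) (b := .inl .w) (by decide) (Sum.elim (mk (st1 z)) bank0)).of_eq
      (by simp [-Sum.elim_update_left, -Sum.elim_update_right]) le_rfl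
  have h3 : Runs _ (Sum.elim (mk (st2 z)) bank0 : Regs R) (Sum.elim (mk (st3 z)) bank0) _ :=
    (runs_unpairW (k := (.inl .w : R)) (a := .inl .a2) (t := .inl .t2) (M := .inl .m2) (P := .inl .p2)
    (by decide) (Sum.elim (mk (st2 z)) bank0) rfl rfl).of_eq
      (by simp [-Sum.elim_update_left, -Sum.elim_update_right]) le_rfl
  have h4 : Runs _ (Sum.elim (mk (st3 z)) bank0 : Regs R) (Sum.elim (mk (st4 z)) bank0) _ :=
    (runs_pour (a := (.inl .a2 : R)) (b := .inl .ab) (by decide) (Sum.elim (mk (st3 z)) bank0)).of_eq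
      (by simp [-Sum.elim_update_left, -Sum.elim_update_right]) le_rfl
  have h5 : Runs _ (Sum.elim (mk (st4 z)) bank0 : Regs R) (Sum.elim (mk (st5 z)) bank0) _ :=
    (runs_unpairW (k := (.inl .ab : R)) (a := .inl .a3) (t := .inl .t3) (M := .inl .m3) (P := .inl .p3)
    (by decide) (Sum.elim (mk (st4 z)) bank0) rfl rfl).of_eq
      (by simp [-Sum.elim_update_left, -Sum.elim_update_right]) le_rfl
  have h6 : Runs _ (Sum.elim (mk (st5 z)) bank0 : Regs R) (Sum.elim (mk (st6 z)) bank0) _ :=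
    (runs_peekCanon (a := (.inl .a3 : R)) (F := .inl .fl) (by decide) (Sum.elim (mk (st5 z)) bank0)
      (by exact Nat.zero_le 1)).of_eq
      (by simp [-Sum.elim_update_left, -Sum.elim_update_right]) le_rfl
  have h7 : Runs _ (Sum.elim (mk (st6 z)) bank0 : Regs R) (Sum.elim (mk (st7 z)) bank0) _ :=
    (runs_andFlag (.inl .m2 : R) (.inl .fl) (Sum.elim (mk (st6 z)) bank0) _ _ rfl rfl).of_eq
      (by simp [-Sum.elim_update_left, -Sum.elim_update_right]) le_rfl
  have h8 : Runs _ (Sum.elim (mk (st7 z)) bank0 : Regs R) (Sum.elim (mk (st8 z)) bank0) _ :=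
    (runs_peekCanon (a := (.inl .t3 : R)) (F := .inl .fl) (by decide) (Sum.elim (mk (st7 z)) bank0)
    (length_flag_le _)).of_eq
      (by simp [-Sum.elim_update_left, -Sum.elim_update_right]) le_rfl
  have h9 : Runs _ (Sum.elim (mk (st8 z)) bank0 : Regs R) (Sum.elim (mk (st9 z)) bank0) _ :=
    (runs_andFlag (.inl .m2 : R) (.inl .fl) (Sum.elim (mk (st8 z)) bank0) _ _ rfl rfl).of_eq
      (by simp [-Sum.elim_update_left, -Sum.elim_update_right]) le_rfl
  have h10 : Runs _ (Sum.elim (mk (st9 z)) bank0 : Regs R) (Sum.elim (mk (st10 z)) bank0) _ :=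
    (runs_peekCanon (a := (.inl .t2 : R)) (F := .inl .fl) (by decide) (Sum.elim (mk (st9 z)) bank0)
    (length_flag_le _)).of_eq
      (by simp [-Sum.elim_update_left, -Sum.elim_update_right]) le_rfl
  have h11 : Runs _ (Sum.elim (mk (st10 z)) bank0 : Regs R) (Sum.elim (mk (st11 z)) bank0) _ :=
    (runs_andFlag (.inl .m2 : R) (.inl .fl) (Sum.elim (mk (st10 z)) bank0) _ _ rfl rfl).of_eq
      (by simp [-Sum.elim_update_left, -Sum.elim_update_right]) le_rfl
  have h12 : Runs _ (Sum.elim (mk (st11 z)) bank0 : Regs R) (Sum.elim (mk (st12 z)) bank0) _ :=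
    (runs_peekTwo (a := (.inl .t3 : R)) (F := .inl .fl) (by decide) (Sum.elim (mk (st11 z)) bank0)
    (length_flag_le _)).of_eq
      (by simp [-Sum.elim_update_left, -Sum.elim_update_right]) le_rfl
  have h13 : Runs _ (Sum.elim (mk (st12 z)) bank0 : Regs R) (Sum.elim (mk (st13 z)) bank0) _ :=
    (runs_andFlag (.inl .m2 : R) (.inl .fl) (Sum.elim (mk (st12 z)) bank0) _ _ rfl rfl).of_eq
      (by simp [-Sum.elim_update_left, -Sum.elim_update_right]) le_rfl
  have h14 : Runs _ (Sum.elim (mk (st13 z)) bank0 : Regs R) (Sum.elim (mk (st14 z)) bank0) _ :=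
    (runs_andFlag (.inl .m2 : R) (.inl .m3) (Sum.elim (mk (st13 z)) bank0) _ _ rfl rfl).of_eq
      (by simp [-Sum.elim_update_left, -Sum.elim_update_right]) le_rfl
  refine (h1.seq (h2.seq (h3.seq (h4.seq (h5.seq (h6.seq (h7.seq (h8.seq (h9.seq (h10.seq (h11.seq (h12.seq (h13.seq h14))))))))))))).of_eq rfl ?_
  simp
  omega


/-! ### What `parse` decides: `ordPost` restated over the components -/

/-- **The validity bit is the test of `ordPost`**: the query re-encodes to itself and `1 < n`.
[folklore] -/
theorem valid_iff (z : List Bool) :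
    valid z = true ↔
      orderQueryEncoding.encode ((decodeNat (qa z), decodeNat (qb z)), decodeNat (qc z)) = qw z ∧
        1 < decodeNat (qb z) := by
  have henc : orderQueryEncoding.encode ((decodeNat (qa z), decodeNat (qb z)), decodeNat (qc z)) =
      boolPair (boolPair (canonBits (qa z)) (canonBits (qb z))) (canonBits (qc z)) := by
    simp [Computability.Encoding.pairBool, encodingNatBool, encodeNat_decodeNat_eq_canonBits]
  rw [henc]
  simp only [valid, Bool.and_eq_true, canonTop_reverse, decide_eq_true_eq]
  constructor
  · rintro ⟨⟨⟨⟨⟨hw, ha⟩, hb⟩, hc⟩, hlen⟩, hab⟩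
    refine ⟨?_, ?_⟩
    · rw [canonBits_eq_self ha, canonBits_eq_self hb, canonBits_eq_self hc]
      have h1 : boolPair (qab z) (qc z) = qw z := boolPair_boolUnpair hw
      have h2 : boolPair (qa z) (qb z) = qab z := boolPair_boolUnpair hab
      rw [h2]; exact h1
    · rw [← bitsToNat_canonBits, canonBits_eq_self hb]; exact (one_lt_bitsToNat_iff hb).2 hlen
  · rintro ⟨hw, hn⟩
    have hwp : wellPaired (qw z) = true := by rw [← hw]; exact wellPaired_boolPair _ _
    have hun : boolUnpair (qw z) = (boolPair (canonBits (qa z)) (canonBits (qb z)), canonBits (qc z)) := by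
      conv_lhs => rw [← hw]
      rw [boolUnpair_boolPair]
    have hab' : qab z = boolPair (canonBits (qa z)) (canonBits (qb z)) := congrArg Prod.fst hun
    have hc' : qc z = canonBits (qc z) := congrArg Prod.snd hun
    have hwp2 : wellPaired (qab z) = true := by
      have := wellPaired_boolPair (canonBits (qa z)) (canonBits (qb z))
      rwa [← hab'] at this
    have hun2 : boolUnpair (qab z) = (canonBits (qa z), canonBits (qb z)) := by
      conv_lhs => rw [hab']
      rw [boolUnpair_boolPair]
    have ha' : qa z = canonBits (qa z) := congrArg Prod.fst hun2
    have hb' : qb z = canonBits (qb z) := congrArg Prod.snd hun2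
    have ha : IsCanonicalNum (qa z) := by
      have := isCanonicalNum_canonBits (qa z); rwa [← ha'] at this
    have hb : IsCanonicalNum (qb z) := by
      have := isCanonicalNum_canonBits (qb z); rwa [← hb'] at this
    have hc : IsCanonicalNum (qc z) := by
      have := isCanonicalNum_canonBits (qc z); rwa [← hc'] at this
    refine ⟨⟨⟨⟨⟨hwp, ha⟩, hb⟩, hc⟩, ?_⟩, hwp2⟩
    rw [← one_lt_bitsToNat_iff hb, ← decodeNat_eq_bitsToNat hb]
    exact hn

/-- **`ordPost` over the parsed components**: the validity bit, then bit `i` of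
`orderFromPrefix x n y` with `x = bitsToNat a`, `n = bitsToNat b`, `i = bitsToNat c`.
[folklore] -/
theorem ordPost_eq (z : List Bool) :
    ordPost z =
      if valid z = true then
        [(orderFromPrefix (bitsToNat (qa z)) (bitsToNat (qb z)) (qy z)).testBit (bitsToNat (qc z))]
      else [false] := by
  have hdec : orderQueryEncoding.decode (qw z) =
      some ((decodeNat (qa z), decodeNat (qb z)), decodeNat (qc z)) := rfl
  unfold ordPost
  simp only [show (boolUnpair z).1 = qw z from rfl, show (boolUnpair z).2 = qy z from rfl, hdec]
  by_cases hv : valid z = true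
  · obtain ⟨henc, hn⟩ := (valid_iff z).1 hv
    rw [if_pos ⟨henc, hn⟩, if_pos hv]
    have hval := hv
    simp only [valid, Bool.and_eq_true, canonTop_reverse, decide_eq_true_eq] at hval
    obtain ⟨⟨⟨⟨⟨-, ha⟩, hb⟩, hc⟩, -⟩, -⟩ := hval
    rw [decodeNat_eq_bitsToNat ha, decodeNat_eq_bitsToNat hb, decodeNat_eq_bitsToNat hc]
  · rw [if_neg (fun h => hv ((valid_iff z).2 h)), if_neg hv]


/-! ### Reading bit `i` of the candidate: a walk with a binary counter -/

/-- One step of the bit walk on the candidate bit `d`: unless done, decrement the counter `x`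
(bank `sub` with `y = 1`); when it was already `0`, output `d` and latch `DONE`. [folklore] -/
def bitBody (d : Bool) : Com R :=
  ifFlag (.inl .DONE) skip
    (bk sub ;; pop (.inr .g) skip skip (Com.push (.inl .OUT) d ;; Com.push (.inl .DONE) true))

/-- The bit walk over the candidate register `CAND`. [folklore] -/
def bitAt : Com R := loop (.inl .CAND) (bitBody true) (bitBody false)

/-- Once done, the walk only drains `CAND`. [folklore] -/
theorem runs_bitAt_done (F : Regs AReg) : ∀ (ds : List Bool) (B : Regs K), B .DONE = [true] →
    B .CAND = ds →
      Runs bitAt (Sum.elim B F) (Sum.elim (Function.update B .CAND []) F) (ds.length * 5 + 1)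
  | [], B, _, hC => by
    refine (Runs.loop_nil _ _ (by simp [hC])).of_eq ?_ (by simp)
    rw [← hC, Function.update_eq_self]
  | d :: ds, B, hD, hC => by
    have hk : (Sum.elim B F : Regs R) (Sum.inl K.CAND) = d :: ds := by simp [hC]
    have hbody : ∀ d' : Bool, Runs (bitBody d') (Function.update (Sum.elim B F : Regs R) (Sum.inl K.CAND) ds)
        (Sum.elim (Function.update B .CAND ds) F) 3 := fun d' => by
      rw [Sum.update_elim_inl]
      exact runs_ifFlag_true _ (by simp [hD]) (Runs.skip _)
    have hrest := runs_bitAt_done F ds (Function.update B .CAND ds) (by simp [hD]) (by simp)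
    rw [Function.update_idem] at hrest
    cases d
    · exact (Runs.loop_false hk (hbody false) hrest).of_eq rfl (by simp; ring_nf; omega)
    · exact (Runs.loop_true hk (hbody true) hrest).of_eq rfl (by simp; ring_nf; omega)

/-- The value of the numeral `1`. [folklore] -/
theorem bitsToNat_one : bitsToNat [true] = 1 := by simp

/-- **The bit walk reads bit `k` of the candidate**, `k` the value of the counter: from `DONE`,
`OUT` empty, counter `xs` in `x` and `1` in `y`, it drains `CAND = ds`, sets
`DONE := [k < |ds|]` and `OUT := [ds[k]]` in that case, in `|ds| · (16|xs| + 40) + 1` steps.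
[folklore] -/
theorem runs_bitAt : ∀ (ds : List Bool) (B : Regs K) (xs zz : List Bool), B .DONE = [] → B .OUT = [] →
    B .CAND = ds →
      ∃ xs' : List Bool, xs'.length ≤ xs.length ∧
        Runs bitAt (Sum.elim B (file xs [true] zz [] [] [] [] []))
          (Sum.elim (Function.update (Function.update (Function.update B .CAND []) .DONE
              (flag (decide (bitsToNat xs < ds.length)))) .OUT
              (if bitsToNat xs < ds.length then [ds.getD (bitsToNat xs) false] else []))
            (file xs' [true] zz [] [] [] [] []))
          (ds.length * (16 * xs.length + 40) + 1)
  | [], B, xs, zz, hD, hO, hC => by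
    refine ⟨xs, le_rfl, (Runs.loop_nil _ _ (by simp [hC])).of_eq ?_ (by simp)⟩
    simp only [List.length_nil, Nat.not_lt_zero, decide_false, flag_false, if_false]
    have e1 : Function.update B K.CAND ([] : List Bool) = B := Function.update_eq_self_iff.2 hC.symm
    have e2 : Function.update B K.DONE ([] : List Bool) = B := Function.update_eq_self_iff.2 hD.symm
    have e3 : Function.update B K.OUT ([] : List Bool) = B := Function.update_eq_self_iff.2 hO.symm
    rw [e1, e2, e3]
  | d :: ds, B, xs, zz, hD, hO, hC => by
    have hk : (Sum.elim B (file xs [true] zz [] [] [] [] []) : Regs R) (Sum.inl K.CAND) = d :: ds := by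
      simp [hC]
    set B₁ := Function.update B .CAND ds with hB₁
    have hsub := (runs_sub xs [true] zz).inr B₁
    rw [subBorrow_iff, bitsToNat_one] at hsub
    by_cases h0 : bitsToNat xs < 1
    · -- the counter is exhausted: output `d`, latch
      simp only [h0, decide_true, cond_true, Bool.not_true, flag_false] at hsub
      have hpop : Runs (pop (.inr .g) skip skip (Com.push (.inl .OUT) d ;; Com.push (.inl .DONE) true) : Com R)
          (Sum.elim B₁ (file xs [true] zz [] [] [] [] []))
          (Sum.elim (Function.update (Function.update B₁ .OUT [d]) .DONE [true]) (file xs [true] zz [] [] [] [] []))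
          4 := by
        refine (Runs.pop_nil _ _ (by simp) ((Runs.push' rfl).seq (Runs.push' ?_))).of_eq rfl (by omega)
        simp [-Sum.elim_update_left, -Sum.elim_update_right, hB₁, hO, hD]
      have hbody : Runs (bitBody d) (Function.update (Sum.elim B (file xs [true] zz [] [] [] [] []) : Regs R)
          (Sum.inl K.CAND) ds)
          (Sum.elim (Function.update (Function.update B₁ .OUT [d]) .DONE [true]) (file xs [true] zz [] [] [] [] []))
          (16 * (xs.length + 1) + 12 + 4 + 3) := by
        rw [Sum.update_elim_inl]
        exact runs_ifFlag_false _ (by simp [hD]) (hsub.seq hpop)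
      have hrest := runs_bitAt_done (file xs [true] zz [] [] [] [] []) ds
        (Function.update (Function.update B₁ .OUT [d]) .DONE [true]) (by simp) (by simp [hB₁])
      refine ⟨xs, le_rfl, ?_⟩
      have hfin : Function.update (Function.update (Function.update B₁ .OUT [d]) .DONE [true]) .CAND [] =
          Function.update (Function.update (Function.update B .CAND []) .DONE
            (flag (decide (bitsToNat xs < (d :: ds).length)))) .OUT
            (if bitsToNat xs < (d :: ds).length then [(d :: ds).getD (bitsToNat xs) false] else []) := by
        have hx0 : bitsToNat xs = 0 := by omega
        rw [hB₁, hx0]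
        funext r
        by_cases h1 : r = .CAND
        · subst h1; simp
        · by_cases h2 : r = .DONE
          · subst h2; simp
          · by_cases h3 : r = .OUT
            · subst h3; simp
            · simp [h1, h2, h3]
      rw [hfin] at hrest
      cases d
      · exact (Runs.loop_false hk hbody hrest).of_eq rfl (by simp; ring_nf; omega)
      · exact (Runs.loop_true hk hbody hrest).of_eq rfl (by simp; ring_nf; omega)
    · -- decrement and go on
      simp only [h0, decide_false, cond_false, Bool.not_false, flag_true] at hsub
      have hval : bitsToNat (subRes xs [true]) = bitsToNat xs - 1 := by
        rw [bitsToNat_subRes _ _ (by rw [bitsToNat_one]; omega), bitsToNat_one]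
      have hlen : (subRes xs [true]).length = xs.length := length_subRes _ _
      have hpop : Runs (pop (.inr .g) skip skip (Com.push (.inl .OUT) d ;; Com.push (.inl .DONE) true) : Com R)
          (Sum.elim B₁ (file (subRes xs [true]) [true] zz [] [] [] [] [true]))
          (Sum.elim B₁ (file (subRes xs [true]) [true] zz [] [] [] [] [])) 2 :=
        Runs.pop_true' _ _ (w := []) (by simp) (by simp [-Sum.elim_update_left, -Sum.elim_update_right]) (Runs.skip _)
      have hbody : Runs (bitBody d) (Function.update (Sum.elim B (file xs [true] zz [] [] [] [] []) : Regs R)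
          (Sum.inl K.CAND) ds)
          (Sum.elim B₁ (file (subRes xs [true]) [true] zz [] [] [] [] [])) (16 * (xs.length + 1) + 12 + 2 + 3) := by
        rw [Sum.update_elim_inl]
        exact runs_ifFlag_false _ (by simp [hD]) (hsub.seq hpop)
      obtain ⟨xs', hxs', hrest⟩ := runs_bitAt ds B₁ (subRes xs [true]) zz (by simp [hB₁, hD]) (by simp [hB₁, hO])
        (by simp [hB₁])
      rw [hval, hlen] at hrest
      refine ⟨xs', by omega, ?_⟩
      have hfin : Function.update (Function.update (Function.update B₁ .CAND []) .DONE
            (flag (decide (bitsToNat xs - 1 < ds.length)))) .OUT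
            (if bitsToNat xs - 1 < ds.length then [ds.getD (bitsToNat xs - 1) false] else []) =
          Function.update (Function.update (Function.update B .CAND []) .DONE
            (flag (decide (bitsToNat xs < (d :: ds).length)))) .OUT
            (if bitsToNat xs < (d :: ds).length then [(d :: ds).getD (bitsToNat xs) false] else []) := by
        obtain ⟨k, hk⟩ : ∃ k, bitsToNat xs = k + 1 := ⟨bitsToNat xs - 1, by omega⟩
        rw [hB₁, Function.update_idem, hk, Nat.add_sub_cancel, List.length_cons]
        have e1 : decide (k < ds.length) = decide (k + 1 < ds.length + 1) := by
          by_cases h : k < ds.length <;> simp [h]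
        rw [e1, List.getD_cons_succ]
        by_cases h : k + 1 < ds.length + 1
        · rw [if_pos h, if_pos (by omega)]
        · rw [if_neg h, if_neg (by omega)]
      rw [hfin] at hrest
      cases d
      · exact (Runs.loop_false hk hbody hrest).of_eq rfl (by simp; ring_nf; omega)
      · exact (Runs.loop_true hk hbody hrest).of_eq rfl (by simp; ring_nf; omega)


/-! ### Recording the first admissible candidate -/

/-- Recording: latch `FOUND`; rebuild the candidate numeral `CAND` (least significant bit first,
canonically completed) from the reversed prefix `P`; save the modulus, load the bit index into
the counter and `1` into `y`; walk; restore the modulus. [folklore] -/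
def record (b : Bool) : Com R :=
  (Com.push (.inl .FOUND) true ;; (bif b then skip else Com.push (.inl .CAND) true)) ;;
  ((copy (.inl .P) (.inl .TC) (.inr .t) (.inr .u) ;;
  (pour (.inl .TC) (.inl .CAND) ;;
  (pour (.inr .y) (.inl .NS) ;;
  (bk (clear .x) ;;
  (copy (.inl .I) (.inr .x) (.inr .t) (.inr .u) ;;
  (Com.push (.inr .y) true ;;
  (bitAt ;;
  (bk (clear .x) ;;
  (bk (clear .y) ;;
  pour (.inl .NS) (.inr .y)))))))))))

/-- The candidate numeral rebuilt by `record` from the reversed prefix `prev = (pre ++ [b])ʳ`: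
`canonBits (pre ++ [b])`. [folklore] -/
def candOf (b : Bool) (prev : List Bool) : List Bool := prev.reverse ++ (bif b then [] else [true])

/-- `candOf` is the canonical completion of the prefix. [folklore] -/
theorem candOf_eq (b : Bool) (pre : List Bool) : candOf b (pre ++ [b]).reverse = canonBits (pre ++ [b]) := by
  cases b
  · rw [candOf, List.reverse_reverse, canonBits_append_false]; rfl
  · rw [candOf, List.reverse_reverse, canonBits_append_true]; simp

/-- **Simulation of `record`.** [folklore] -/
theorem runs_record (b : Bool) (B : Regs K) (prev cL res nL zj : List Bool) (hF : B .FOUND = [])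
    (hC : B .CAND = []) (hT : B .TC = []) (hN : B .NS = []) (hD : B .DONE = []) (hO : B .OUT = [])
    (hP : B .P = prev) (hI : B .I = cL) (hres : res.length ≤ nL.length) :
    Runs (record b) (Sum.elim B (file res nL zj [] [] [] [] []))
      (Sum.elim (Function.update (Function.update (Function.update B .FOUND [true]) .DONE
          (flag (decide (bitsToNat cL < (candOf b prev).length)))) .OUT
          (if bitsToNat cL < (candOf b prev).length then [(candOf b prev).getD (bitsToNat cL) false] else []))
        (file [] nL zj [] [] [] [] []))
      ((prev.length + 1) * (16 * cL.length + 40) + 13 * prev.length + 8 * nL.length + 12 * cL.length + 18) := by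
  -- latch FOUND, seed CAND
  set B₁ := Function.update (Function.update B .FOUND [true]) .CAND (bif b then [] else [true]) with hB₁
  have h1 : Runs (Com.push (.inl .FOUND) true ;; (bif b then skip else Com.push (.inl .CAND) true) : Com R)
      (Sum.elim B (file res nL zj [] [] [] [] [])) (Sum.elim B₁ (file res nL zj [] [] [] [] [])) 2 := by
    have hp : Runs (Com.push (.inl .FOUND) true : Com R) (Sum.elim B (file res nL zj [] [] [] [] []))
        (Sum.elim (Function.update B .FOUND [true]) (file res nL zj [] [] [] [] [])) 1 :=
      Runs.push' (by simp [-Sum.elim_update_left, -Sum.elim_update_right, hF])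
    cases b
    · refine (hp.seq (Runs.push' ?_)).of_eq rfl (by omega)
      simp [-Sum.elim_update_left, -Sum.elim_update_right, hB₁, hC]
    · refine (hp.seq (Runs.skip _)).of_eq ?_ (by omega)
      rw [hB₁]; congr 1
      simp only [cond_true]
      refine (Function.update_eq_self_iff.2 ?_).symm
      simp [hC]
  -- rebuild the candidate
  have h2 : Runs (copy (.inl .P) (.inl .TC) (.inr .t) (.inr .u) : Com R) (Sum.elim B₁ (file res nL zj [] [] [] [] []))
      (Sum.elim (Function.update B₁ .TC prev) (file res nL zj [] [] [] [] [])) (10 * prev.length + 3) :=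
    (runs_copy (by decide) (by decide) (by decide) (by decide) (by decide) (by decide) _ rfl rfl).of_eq
      (by simp [-Sum.elim_update_left, -Sum.elim_update_right, hB₁, hP, hT]) (by simp [hB₁, hP])
  have h3 : Runs (pour (.inl .TC) (.inl .CAND) : Com R)
      (Sum.elim (Function.update B₁ .TC prev) (file res nL zj [] [] [] [] []))
      (Sum.elim (Function.update (Function.update (Function.update B₁ .TC prev) .TC []) .CAND (candOf b prev))
        (file res nL zj [] [] [] [] [])) (3 * prev.length + 1) :=
    (runs_pour (by decide) _).of_eq
      (by simp [-Sum.elim_update_left, -Sum.elim_update_right, hB₁, candOf]) (by simp)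
  set B₂ := Function.update (Function.update (Function.update B₁ .TC prev) .TC []) .CAND (candOf b prev) with hB₂
  -- save the modulus, load the counter
  have h4 : Runs (pour (.inr .y) (.inl .NS) : Com R) (Sum.elim B₂ (file res nL zj [] [] [] [] []))
      (Sum.elim (Function.update B₂ .NS nL.reverse) (file res [] zj [] [] [] [] [])) (3 * nL.length + 1) :=
    (runs_pour (by decide) _).of_eq
      (by simp [-Sum.elim_update_left, -Sum.elim_update_right, hB₂, hB₁, hN]) (by simp)
  set B₃ := Function.update B₂ .NS nL.reverse with hB₃
  have h5 : Runs (bk (clear .x) : Com R) (Sum.elim B₃ (file res [] zj [] [] [] [] []))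
      (Sum.elim B₃ (file [] [] zj [] [] [] [] [])) (2 * res.length + 1) :=
    ((runs_clear AReg.x (file res [] zj [] [] [] [] [])).inr B₃).of_eq (by simp) (by simp)
  have h6 : Runs (copy (.inl .I) (.inr .x) (.inr .t) (.inr .u) : Com R) (Sum.elim B₃ (file [] [] zj [] [] [] [] []))
      (Sum.elim B₃ (file cL [] zj [] [] [] [] [])) (10 * cL.length + 3) :=
    (runs_copy (by decide) (by decide) (by decide) (by decide) (by decide) (by decide) _ rfl rfl).of_eq
      (by simp [-Sum.elim_update_left, -Sum.elim_update_right, hB₃, hB₂, hB₁, hI]) (by simp [hB₃, hB₂, hB₁, hI])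
  have h7 : Runs (Com.push (.inr .y) true : Com R) (Sum.elim B₃ (file cL [] zj [] [] [] [] []))
      (Sum.elim B₃ (file cL [true] zj [] [] [] [] [])) 1 := Runs.push' (by simp)
  -- the walk
  obtain ⟨xs', hxs', h8⟩ := runs_bitAt (candOf b prev) B₃ cL zj (by simp [hB₃, hB₂, hB₁, hD])
    (by simp [hB₃, hB₂, hB₁, hO]) (by simp [hB₃, hB₂])
  set B₄ := Function.update (Function.update (Function.update B₃ .CAND []) .DONE
    (flag (decide (bitsToNat cL < (candOf b prev).length)))) .OUT
    (if bitsToNat cL < (candOf b prev).length then [(candOf b prev).getD (bitsToNat cL) false] else []) with hB₄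
  -- restore the modulus
  have h9 : Runs (bk (clear .x) : Com R) (Sum.elim B₄ (file xs' [true] zj [] [] [] [] []))
      (Sum.elim B₄ (file [] [true] zj [] [] [] [] [])) (2 * xs'.length + 1) :=
    ((runs_clear AReg.x (file xs' [true] zj [] [] [] [] [])).inr B₄).of_eq (by simp) (by simp)
  have h10 : Runs (bk (clear .y) : Com R) (Sum.elim B₄ (file [] [true] zj [] [] [] [] []))
      (Sum.elim B₄ (file [] [] zj [] [] [] [] [])) 3 :=
    ((runs_clear AReg.y (file [] [true] zj [] [] [] [] [])).inr B₄).of_eq (by simp) (by simp)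
  have h11 : Runs (pour (.inl .NS) (.inr .y) : Com R) (Sum.elim B₄ (file [] [] zj [] [] [] [] []))
      (Sum.elim (Function.update B₄ .NS []) (file [] nL zj [] [] [] [] [])) (3 * nL.length + 1) :=
    (runs_pour (by decide) _).of_eq
      (by simp [-Sum.elim_update_left, -Sum.elim_update_right, hB₄, hB₃]) (by simp [hB₄, hB₃])
  have hcand : (candOf b prev).length ≤ prev.length + 1 := by
    cases b <;> simp [candOf]
  refine ((h1.seq (h2.seq (h3.seq (h4.seq (h5.seq (h6.seq (h7.seq (h8.seq (h9.seq (h10.seq h11))))))))))).of_eq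
    ?_ ?_
  · clear h1 h2 h3 h4 h5 h6 h7 h8 h9 h10 h11
    rw [hB₄, hB₃, hB₂, hB₁]
    congr 1
    funext r
    simp only [Function.update_apply]
    split_ifs <;> (first | rfl | simp_all)
  · have := Nat.mul_le_mul_right (16 * cL.length + 40) hcand
    nlinarith [hxs', hres, hcand, this]


/-! ### Normal forms of the modular-arithmetic results -/

/-- Normal numerals: empty or ending in `true` (the shape of `norm`, `StackArith.lean`).
[folklore] -/
def IsNormal (l : List Bool) : Prop := l = [] ∨ ∃ v, l = v ++ [true]

/-- `norm` outputs are normal. [folklore] -/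
theorem isNormal_norm (w : List Bool) : IsNormal (norm w) := norm_eq_nil_or_getLast w

/-- Horner steps output normal numerals. [folklore] -/
theorem isNormal_modMulStepRes (b : Bool) (acc n xx : List Bool) : IsNormal (modMulStepRes b acc n xx) := by
  cases b
  · exact isNormal_norm _
  · exact isNormal_norm _

/-- `modMul` from a normal accumulator outputs a normal numeral. [folklore] -/
theorem isNormal_modMulRes : ∀ (bs acc n xx : List Bool), IsNormal acc → IsNormal (modMulRes bs acc n xx)
  | [], _, _, _, h => h
  | b :: bs, acc, n, xx, _ => isNormal_modMulRes bs _ n xx (isNormal_modMulStepRes b acc n xx)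

/-- `modExp` from a normal `x` outputs a normal numeral. [folklore] -/
theorem isNormal_modExpRes : ∀ (bs r n xb : List Bool), IsNormal r → IsNormal (modExpRes bs r n xb)
  | [], _, _, _, h => h
  | b :: bs, r, n, xb, _ => by
    refine isNormal_modExpRes bs _ n xb ?_
    cases b
    · exact isNormal_modMulRes _ _ _ _ (Or.inl rfl)
    · exact isNormal_modMulRes _ _ _ _ (Or.inl rfl)

/-- A normal numeral of value `1` is `[true]`. [folklore] -/
theorem eq_one_of_isNormal {l : List Bool} (h : IsNormal l) (hv : bitsToNat l = 1) : l = [true] :=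
  eq_of_bitsToNat_eq_of_canonical l [true] h (Or.inr ⟨[], rfl⟩) (by rw [hv]; simp)

/-! ### One round of the scan: extend the prefix, exponentiate, test, record -/

/-- The exponent register built from the reversed prefix `prev = (pre ++ [b])ʳ`: the canonical
completion of the prefix, most significant bit first. [folklore] -/
def erevOf (b : Bool) (prev : List Bool) : List Bool := bif b then prev else true :: prev

/-- `erevOf` is the reversed canonical completion of the prefix. [folklore] -/
theorem erevOf_eq (b : Bool) (pre : List Bool) :
    erevOf b (pre ++ [b]).reverse = (canonBits (pre ++ [b])).reverse := by
  cases b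
  · rw [erevOf, canonBits_append_false]; simp
  · rw [erevOf, canonBits_append_true]; simp

/-- One step of the scan on the bit `b`. [folklore] -/
def step (x n : ℕ) (pre : List Bool) (b : Bool) (fnd : Option (List Bool)) : Option (List Bool) :=
  match fnd with
  | some c => some c
  | none => if candOK x n (pre ++ [b]) then some (canonBits (pre ++ [b])) else none

/-- The scan unrolled once. [folklore] -/
theorem scan_cons (x n : ℕ) (pre : List Bool) (b : Bool) (rest : List Bool) (fnd : Option (List Bool)) :
    scan x n pre (b :: rest) fnd = scan x n (pre ++ [b]) rest (step x n pre b fnd) := by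
  simp only [scan]; rfl

/-- The `FOUND` register for a scan state. [folklore] -/
def fdReg (fnd : Option (List Bool)) : List Bool := flag fnd.isSome

/-- The `DONE` register for a scan state and bit index `i`. [folklore] -/
def dnReg (i : ℕ) : Option (List Bool) → List Bool
  | none => []
  | some cand => flag (decide (i < cand.length))

/-- The `OUT` register for a scan state and bit index `i`. [folklore] -/
def outReg (i : ℕ) : Option (List Bool) → List Bool
  | none => []
  | some cand => if i < cand.length then [cand.getD i false] else []

/-- The outer register file during the main loop over a base file `B`: unread bits `rest`,
reversed prefix, flag junk `f`, and the latches of the scan state `fnd`. [folklore] -/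
def kfile (B : Regs K) (i : ℕ) (rest pre : List Bool) (fnd : Option (List Bool)) (f : List Bool) : Regs K :=
  Function.update (Function.update (Function.update (Function.update (Function.update
    (Function.update B .P pre.reverse) .fl f) .FOUND (fdReg fnd)) .DONE (dnReg i fnd)) .OUT (outReg i fnd)) .Y rest

/-- Rewriting the unread bits. [folklore] -/
theorem update_kfile_Y (B : Regs K) (i : ℕ) (rest rest' pre : List Bool) (fnd : Option (List Bool))
    (f : List Bool) : Function.update (kfile B i rest pre fnd f) .Y rest' = kfile B i rest' pre fnd f := by
  unfold kfile; rw [Function.update_idem]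

/-- A register file is the loop file `kfile B …` if it reads accordingly. [folklore] -/
theorem eq_kfile (T B : Regs K) (i : ℕ) (rest pre : List Bool) (fnd : Option (List Bool)) (f : List Bool)
    (hY : T .Y = rest) (hP : T .P = pre.reverse) (hfl : T .fl = f) (hF : T .FOUND = fdReg fnd)
    (hD : T .DONE = dnReg i fnd) (hO : T .OUT = outReg i fnd)
    (hrest : ∀ r, r ≠ .Y → r ≠ .P → r ≠ .fl → r ≠ .FOUND → r ≠ .DONE → r ≠ .OUT → T r = B r) :
    T = kfile B i rest pre fnd f := by
  funext r
  by_cases h1 : r = .Y; · subst h1; simp [kfile, hY]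
  by_cases h2 : r = .P; · subst h2; simp [kfile, hP]
  by_cases h3 : r = .fl; · subst h3; simp [kfile, hfl]
  by_cases h4 : r = .FOUND; · subst h4; simp [kfile, hF]
  by_cases h5 : r = .DONE; · subst h5; simp [kfile, hD]
  by_cases h6 : r = .OUT; · subst h6; simp [kfile, hO]
  rw [hrest r h1 h2 h3 h4 h5 h6]
  simp [kfile, h1, h2, h3, h4, h5, h6]

/-- One round of the main loop on the bit `b` of `y`: extend the reversed prefix `P`, build the
exponent `E`, set `x := 1` and exponentiate (`modExp`), test `x = 1` (`peekOne`), and record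
the candidate if it is admissible and none was recorded before. [folklore] -/
def mbody (b : Bool) : Com R :=
  Com.push (.inl .P) b ;;
  (copy (.inl .P) (.inl .E) (.inr .t) (.inr .u) ;;
  ((bif b then skip else Com.push (.inl .E) true) ;;
  (bk (clear .x) ;;
  (Com.push (.inr .x) true ;;
  (modExp K.E K.XB K.M ;;
  (peekOne (.inr .x) (.inl .fl) ;;
  ifFlag (.inl .fl) (ifFlag (.inl .FOUND) skip (record b)) skip))))))

/-- The main loop over the bits of `y`. [folklore] -/
def mloop : Com R := loop (.inl .Y) (mbody true) (mbody false)

/-- Cost of one round in terms of the prefix length `p`, modulus length `L`, index length `c`.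
[folklore] -/
def mbodyCost (p L c : ℕ) : ℕ :=
  (p + 2) * (modExpStepCost L + 2) + (p + 2) * (16 * c + 40) + 23 * p + 10 * L + 12 * c + 70

/-- The round cost is monotone in the prefix length. [folklore] -/
theorem mbodyCost_mono {p p' : ℕ} (h : p ≤ p') (L c : ℕ) : mbodyCost p L c ≤ mbodyCost p' L c := by
  unfold mbodyCost
  have h1 := Nat.mul_le_mul_right (modExpStepCost L + 2) (Nat.add_le_add_right h 2)
  have h2 := Nat.mul_le_mul_right (16 * c + 40) (Nat.add_le_add_right h 2)
  omega

/-- The round cost is monotone in all three sizes. [folklore] -/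
theorem mbodyCost_mono3 {p L c s : ℕ} (hp : p ≤ s) (hL : L ≤ s) (hc : c ≤ s) :
    mbodyCost p L c ≤ mbodyCost s s s := by
  unfold mbodyCost
  have hmsc : modExpStepCost L ≤ modExpStepCost s := by
    unfold modExpStepCost
    have := Nat.pow_le_pow_left hL 2
    nlinarith
  have h1 := Nat.mul_le_mul (Nat.add_le_add_right hp 2) (Nat.add_le_add_right hmsc 2)
  have h2 := Nat.mul_le_mul (Nat.add_le_add_right hp 2) (show 16 * c + 40 ≤ 16 * s + 40 by omega)
  generalize (p + 2) * (modExpStepCost L + 2) = A1 at h1 ⊢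
  generalize (s + 2) * (modExpStepCost s + 2) = A2 at h1 ⊢
  generalize (p + 2) * (16 * c + 40) = A3 at h2 ⊢
  generalize (s + 2) * (16 * s + 40) = A4 at h2 ⊢
  omega

/-- **The exponentiation tests admissibility**: the result of `modExp` on the exponent
`erevOf b prev` from `x = 1` with base `xb ≡ x (mod n)` is the numeral `[true]` iff the prefix
is an admissible candidate. [folklore] -/
theorem modExpRes_eq_one_iff (b : Bool) (pre : List Bool) (nL xb : List Bool) (x : ℕ)
    (hn : 1 < bitsToNat nL) (hxb : bitsToNat xb = x % bitsToNat nL) :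
    (modExpRes (erevOf b (pre ++ [b]).reverse) [true] nL xb = [true]) =
      (candOK x (bitsToNat nL) (pre ++ [b]) = true) := by
  have hx : bitsToNat xb < bitsToNat nL := by rw [hxb]; exact Nat.mod_lt _ (by omega)
  have hv := bitsToNat_modExpRes_one (erevOf b (pre ++ [b]).reverse) nL xb hn hx
  rw [hxb, ← Nat.pow_mod, erevOf_eq, List.reverse_reverse, bitsToNat_canonBits] at hv
  rw [erevOf_eq]
  have hpos : 0 < decodeNat (pre ++ [b]) := decodeNat_pos (by simp)
  simp only [candOK, hpos, true_and, decide_eq_true_eq, Nat.ModEq, Nat.mod_eq_of_lt hn, eq_iff_iff]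
  constructor
  · intro h
    rw [← hv, h]; simp
  · intro h
    exact eq_one_of_isNormal (isNormal_modExpRes _ _ _ _ (Or.inr ⟨[], rfl⟩)) (by rw [hv, h])


/-- A numeral of value `> 1` is nonempty. [folklore] -/
theorem length_pos_of_one_lt {l : List Bool} (h : 1 < bitsToNat l) : 1 ≤ l.length := by
  cases l with
  | nil => simp at h
  | cons b l => simp

/-- Reading the registers of `kfile` that the round does not own. [folklore] -/
theorem kfile_apply_of_ne (B : Regs K) (i : ℕ) (rest pre : List Bool) (fnd : Option (List Bool)) (f : List Bool)
    {r : K} (hY : r ≠ .Y) (hP : r ≠ .P) (hfl : r ≠ .fl) (hF : r ≠ .FOUND) (hD : r ≠ .DONE) (hO : r ≠ .OUT) :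
    kfile B i rest pre fnd f r = B r := by
  simp [kfile, hY, hP, hfl, hF, hD, hO]

/-- **Simulation of one round of the main loop** (see `mbody`): from the loop file over a base
`B` (kernel registers empty, `XB = xb ≡ x`, `I = bin i`) and a bank `x = junk, y = n, z = junk`,
the round extends the prefix by `b` and advances the scan state by `step`, within
`mbodyCost |pre| |n| |bin i|`. [folklore] -/
theorem runs_mbody (b : Bool) (B : Regs K) (x i : ℕ) (rest pre f xj zj nL xb cL : List Bool)
    (fnd : Option (List Bool))
    (hE : B .E = []) (hM : B .M = []) (hXB : B .XB = xb) (hI : B .I = cL) (hT : B .TC = [])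
    (hC : B .CAND = []) (hN : B .NS = [])
    (hn : 1 < bitsToNat nL) (hxb : bitsToNat xb = x % bitsToNat nL) (hxbl : xb.length ≤ nL.length)
    (hi : bitsToNat cL = i) (hf : f.length ≤ 1) (hxj : xj.length ≤ nL.length) (hzj : zj.length ≤ nL.length) :
    ∃ xj' zj' f' : List Bool, xj'.length ≤ nL.length ∧ zj'.length ≤ nL.length ∧ f'.length ≤ 1 ∧
      Runs (mbody b) (Sum.elim (kfile B i rest pre fnd f) (file xj nL zj [] [] [] [] []))
        (Sum.elim (kfile B i rest (pre ++ [b]) (step x (bitsToNat nL) pre b fnd) f')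
          (file xj' nL zj' [] [] [] [] []))
        (mbodyCost pre.length nL.length cL.length) := by
  have hnl : 1 ≤ nL.length := length_pos_of_one_lt hn
  have hx : bitsToNat xb < bitsToNat nL := by rw [hxb]; exact Nat.mod_lt _ (by omega)
  set T0 := kfile B i rest pre fnd f with hT0
  set prev := (pre ++ [b]).reverse with hprev
  have hprev' : prev = b :: pre.reverse := by simp [hprev]
  have hplen : prev.length = pre.length + 1 := by simp [hprev]
  -- reads of the base registers through `T0`
  have rE : T0 .E = [] := by rw [hT0, kfile_apply_of_ne] <;> first | decide | exact hE
  have rM : T0 .M = [] := by rw [hT0, kfile_apply_of_ne] <;> first | decide | exact hM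
  have rXB : T0 .XB = xb := by rw [hT0, kfile_apply_of_ne] <;> first | decide | exact hXB
  have rI : T0 .I = cL := by rw [hT0, kfile_apply_of_ne] <;> first | decide | exact hI
  have rT : T0 .TC = [] := by rw [hT0, kfile_apply_of_ne] <;> first | decide | exact hT
  have rC : T0 .CAND = [] := by rw [hT0, kfile_apply_of_ne] <;> first | decide | exact hC
  have rN : T0 .NS = [] := by rw [hT0, kfile_apply_of_ne] <;> first | decide | exact hN
  have rP : T0 .P = pre.reverse := by simp [hT0, kfile]
  have rfl' : T0 .fl = f := by simp [hT0, kfile]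
  have rF : T0 .FOUND = fdReg fnd := by simp [hT0, kfile]
  have rD : T0 .DONE = dnReg i fnd := by simp [hT0, kfile]
  have rO : T0 .OUT = outReg i fnd := by simp [hT0, kfile]
  -- M1: extend the prefix
  set T1 := Function.update T0 .P prev with hT1
  have h1 : Runs (Com.push (.inl .P) b : Com R) (Sum.elim T0 (file xj nL zj [] [] [] [] []))
      (Sum.elim T1 (file xj nL zj [] [] [] [] [])) 1 :=
    Runs.push' (by simp [-Sum.elim_update_left, -Sum.elim_update_right, hT1, rP, hprev'])
  -- M2, M3: the exponent
  have h2 : Runs (copy (.inl .P) (.inl .E) (.inr .t) (.inr .u) : Com R) (Sum.elim T1 (file xj nL zj [] [] [] [] []))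
      (Sum.elim (Function.update T1 .E prev) (file xj nL zj [] [] [] [] [])) (10 * prev.length + 3) :=
    (runs_copy (by decide) (by decide) (by decide) (by decide) (by decide) (by decide) _ rfl rfl).of_eq
      (by simp [-Sum.elim_update_left, -Sum.elim_update_right, hT1, rE]) (by simp [hT1])
  set T3 := Function.update T1 .E (erevOf b prev) with hT3
  have h3 : Runs (bif b then skip else Com.push (.inl .E) true : Com R)
      (Sum.elim (Function.update T1 .E prev) (file xj nL zj [] [] [] [] []))
      (Sum.elim T3 (file xj nL zj [] [] [] [] [])) 1 := by
    cases b
    · exact Runs.push' (by simp [-Sum.elim_update_left, -Sum.elim_update_right, hT3, erevOf])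
    · exact (Runs.skip _).of_eq (by simp [-Sum.elim_update_left, -Sum.elim_update_right, hT3, erevOf]) (by omega)
  have r3E : T3 .E = erevOf b prev := by simp [hT3]
  have r3M : T3 .M = [] := by simp [hT3, hT1, rM]
  have r3XB : T3 .XB = xb := by simp [hT3, hT1, rXB]
  -- M4, M5: x := 1
  have h4 : Runs (bk (clear .x) : Com R) (Sum.elim T3 (file xj nL zj [] [] [] [] []))
      (Sum.elim T3 (file [] nL zj [] [] [] [] [])) (2 * xj.length + 1) :=
    ((runs_clear AReg.x (file xj nL zj [] [] [] [] [])).inr T3).of_eq (by simp) (by simp)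
  have h5 : Runs (Com.push (.inr .x) true : Com R) (Sum.elim T3 (file [] nL zj [] [] [] [] []))
      (Sum.elim T3 (file [true] nL zj [] [] [] [] [])) 1 := Runs.push' (by simp)
  -- M6: exponentiate
  obtain ⟨zj', hzj', h6⟩ := runs_modExp (κ := K) (e := K.E) (xb := K.XB) (m := K.M) (by decide) (by decide)
    (by decide) (erevOf b prev) T3 [true] nL zj r3E r3M (by simpa using hn) (by rw [r3XB]; exact hx)
    (by simpa using hnl) hzj (by rw [r3XB]; exact hxbl)
  rw [r3XB] at h6
  set res := modExpRes (erevOf b prev) [true] nL xb with hres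
  have hresl : res.length ≤ nL.length :=
    (modExpRes_lt_and_length _ _ _ _ (by simpa using hn) hx (by simpa using hnl)).2
  set T4 := Function.update T3 .E [] with hT4
  -- M7: test `x = 1`
  have h7 := runs_peekOne (a := (.inr .x : R)) (F := .inl .fl) (by decide)
    (Sum.elim T4 (file res nL zj' [] [] [] [] [])) (by simp [hT4, hT3, hT1, rfl']; exact hf)
  set okb := candOK x (bitsToNat nL) (pre ++ [b]) with hokb
  have hiff : res = [true] ↔ okb = true := by
    rw [hokb, hres, hprev]; exact (modExpRes_eq_one_iff b pre nL xb x hn hxb).to_iff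
  have hdec : ∀ [d : Decidable (res = [true])], @decide (res = [true]) d = okb := by
    intro d
    cases h : okb
    · exact decide_eq_false fun e => by
        rw [hiff, h] at e
        exact Bool.false_ne_true e
    · exact decide_eq_true (hiff.2 h)
  set T5 := Function.update T4 .fl (flag okb) with hT5
  have h7' : Runs (peekOne (.inr .x) (.inl .fl) : Com R) (Sum.elim T4 (file res nL zj' [] [] [] [] []))
      (Sum.elim T5 (file res nL zj' [] [] [] [] [])) 9 :=
    h7.of_eq (by rw [Sum.update_elim_inl, hT5]; congr 2; exact congrArg flag hdec) le_rfl
  have r5fl : T5 .fl = flag okb := by simp [hT5]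
  have r5F : T5 .FOUND = fdReg fnd := by simp [hT5, hT4, hT3, hT1, rF]
  have r5D : T5 .DONE = dnReg i fnd := by simp [hT5, hT4, hT3, hT1, rD]
  have r5O : T5 .OUT = outReg i fnd := by simp [hT5, hT4, hT3, hT1, rO]
  have r5P : T5 .P = prev := by simp [hT5, hT4, hT3, hT1]
  have r5I : T5 .I = cL := by simp [hT5, hT4, hT3, hT1, rI]
  have r5T : T5 .TC = [] := by simp [hT5, hT4, hT3, hT1, rT]
  have r5C : T5 .CAND = [] := by simp [hT5, hT4, hT3, hT1, rC]
  have r5N : T5 .NS = [] := by simp [hT5, hT4, hT3, hT1, rN]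
  -- the common prefix of the round
  have herev : (erevOf b prev).length ≤ pre.length + 2 := by
    cases b <;> simp [erevOf, hplen]
  have hm1 := Nat.mul_le_mul_right (modExpStepCost nL.length + 2) herev
  have hco : candOf b prev = canonBits (pre ++ [b]) := by rw [hprev]; exact candOf_eq b pre
  -- M8: branch on admissibility and on the latch
  by_cases hokt : okb = true
  · rcases hfnd : fnd with _ | ⟨cand⟩
    · -- admissible and nothing recorded yet: record
      subst hfnd
      have h8r := runs_record b T5 prev cL res nL zj' (by rw [r5F]; rfl) r5C r5T r5N (by rw [r5D]; rfl)
        (by rw [r5O]; rfl) r5P r5I hresl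
      rw [hco, hi] at h8r
      have h8 : Runs (ifFlag (.inl .fl) (ifFlag (.inl .FOUND) skip (record b)) skip : Com R)
          (Sum.elim T5 (file res nL zj' [] [] [] [] [])) _ (_ + 3 + 3) :=
        runs_ifFlag_true _ (by simp [r5fl, hokt]) (runs_ifFlag_false _ (by simp [r5F, fdReg]) h8r)
      refine ⟨[], zj', flag okb, by simp, hzj', length_flag_le _, (h1.seq (h2.seq (h3.seq (h4.seq (h5.seq (h6.seq (h7'.seq h8))))))).of_eq ?_ ?_⟩
      · have hstep : step x (bitsToNat nL) pre b none = some (canonBits (pre ++ [b])) := by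
          simp [step, ← hokb, hokt]
        rw [hstep]
        clear h1 h2 h3 h4 h5 h6 h7 h7' h8 h8r
        congr 1
        refine eq_kfile _ _ _ _ _ _ _ ?_ ?_ ?_ ?_ ?_ ?_ ?_
        · simp [hT5, hT4, hT3, hT1, hT0, kfile]
        · simp [hT5, hT4, hT3, hT1, hprev]
        · simp [hT5]
        · simp [fdReg]
        · simp [dnReg]
        · simp [outReg]
        · intro r h1 h2 h3 h4 h5 h6
          by_cases h7 : r = .E
          · subst h7; simp [hT5, hT4, hE]
          · simp [h1, h2, h3, h4, h5, h6, h7, hT5, hT4, hT3, hT1, hT0, kfile]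
      · rw [mbodyCost, hplen]
        have e2 : (pre.length + 1 + 1) * (16 * cL.length + 40) = (pre.length + 2) * (16 * cL.length + 40) := rfl
        rw [e2]
        generalize (erevOf b prev).length * (modExpStepCost nL.length + 2) = A at hm1 ⊢
        generalize (pre.length + 2) * (modExpStepCost nL.length + 2) = Bq at hm1 ⊢
        generalize (pre.length + 2) * (16 * cL.length + 40) = Cq
        omega
    · -- admissible but already recorded: skip
      subst hfnd
      have h8 : Runs (ifFlag (.inl .fl) (ifFlag (.inl .FOUND) skip (record b)) skip : Com R)
          (Sum.elim T5 (file res nL zj' [] [] [] [] [])) (Sum.elim T5 (file res nL zj' [] [] [] [] [])) (0 + 3 + 3) :=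
        runs_ifFlag_true _ (by simp [r5fl, hokt]) (runs_ifFlag_true _ (by simp [r5F, fdReg]) (Runs.skip _))
      refine ⟨res, zj', flag okb, hresl, hzj', length_flag_le _, (h1.seq (h2.seq (h3.seq (h4.seq (h5.seq (h6.seq (h7'.seq h8))))))).of_eq ?_ ?_⟩
      · have hstep : step x (bitsToNat nL) pre b (some cand) = some cand := rfl
        rw [hstep]
        clear h1 h2 h3 h4 h5 h6 h7 h7' h8
        congr 1
        refine eq_kfile _ _ _ _ _ _ _ ?_ ?_ ?_ ?_ ?_ ?_ ?_
        · simp [hT5, hT4, hT3, hT1, hT0, kfile]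
        · simp [hT5, hT4, hT3, hT1, hprev]
        · simp [hT5]
        · simp [hT5, hT4, hT3, hT1, rF]
        · simp [hT5, hT4, hT3, hT1, rD]
        · simp [hT5, hT4, hT3, hT1, rO]
        · intro r h1 h2 h3 h4 h5 h6
          by_cases h7 : r = .E
          · subst h7; simp [hT5, hT4, hE]
          · simp [h1, h2, h3, h4, h5, h6, h7, hT5, hT4, hT3, hT1, hT0, kfile]
      · rw [mbodyCost, hplen]
        generalize (erevOf b prev).length * (modExpStepCost nL.length + 2) = A at hm1 ⊢
        generalize (pre.length + 2) * (modExpStepCost nL.length + 2) = Bq at hm1 ⊢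
        generalize (pre.length + 2) * (16 * cL.length + 40) = Cq
        omega
  · -- not admissible: skip
    have hokf : okb = false := by rwa [Bool.not_eq_true] at hokt
    have h8 : Runs (ifFlag (.inl .fl) (ifFlag (.inl .FOUND) skip (record b)) skip : Com R)
        (Sum.elim T5 (file res nL zj' [] [] [] [] [])) (Sum.elim T5 (file res nL zj' [] [] [] [] [])) (0 + 3) :=
      runs_ifFlag_false _ (by simp [r5fl, hokf]) (Runs.skip _)
    refine ⟨res, zj', flag okb, hresl, hzj', length_flag_le _, (h1.seq (h2.seq (h3.seq (h4.seq (h5.seq (h6.seq (h7'.seq h8))))))).of_eq ?_ ?_⟩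
    · have hstep : step x (bitsToNat nL) pre b fnd = fnd := by
        cases fnd <;> simp [step, ← hokb, hokf]
      rw [hstep]
      clear h1 h2 h3 h4 h5 h6 h7 h7' h8
      congr 1
      refine eq_kfile _ _ _ _ _ _ _ ?_ ?_ ?_ ?_ ?_ ?_ ?_
      · simp [hT5, hT4, hT3, hT1, hT0, kfile]
      · simp [hT5, hT4, hT3, hT1, hprev]
      · simp [hT5]
      · simp [hT5, hT4, hT3, hT1, rF]
      · simp [hT5, hT4, hT3, hT1, rD]
      · simp [hT5, hT4, hT3, hT1, rO]
      · intro r h1 h2 h3 h4 h5 h6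
        by_cases h7 : r = .E
        · subst h7; simp [hT5, hT4, hE]
        · simp [h1, h2, h3, h4, h5, h6, h7, hT5, hT4, hT3, hT1, hT0, kfile]
    · rw [mbodyCost, hplen]
      generalize (erevOf b prev).length * (modExpStepCost nL.length + 2) = A at hm1 ⊢
      generalize (pre.length + 2) * (modExpStepCost nL.length + 2) = Bq at hm1 ⊢
      generalize (pre.length + 2) * (16 * cL.length + 40) = Cq
      omega


/-! ### The main loop -/

/-- **Simulation of the main loop**: from the loop file with unread bits `rest` and prefix `pre`,
the loop drains `rest` and advances the scan state to `scan x n pre rest fnd`, within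
`|rest| · (mbodyCost (|pre| + |rest|) |n| |bin i| + 2) + 1` steps. [folklore] -/
theorem runs_mloop (B : Regs K) (x i : ℕ) (nL xb cL : List Bool)
    (hE : B .E = []) (hM : B .M = []) (hXB : B .XB = xb) (hI : B .I = cL) (hT : B .TC = [])
    (hC : B .CAND = []) (hN : B .NS = [])
    (hn : 1 < bitsToNat nL) (hxb : bitsToNat xb = x % bitsToNat nL) (hxbl : xb.length ≤ nL.length)
    (hi : bitsToNat cL = i) :
    ∀ (rest pre f xj zj : List Bool) (fnd : Option (List Bool)), f.length ≤ 1 → xj.length ≤ nL.length →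
      zj.length ≤ nL.length →
      ∃ xj' zj' f' : List Bool, xj'.length ≤ nL.length ∧ zj'.length ≤ nL.length ∧ f'.length ≤ 1 ∧
        Runs mloop (Sum.elim (kfile B i rest pre fnd f) (file xj nL zj [] [] [] [] []))
          (Sum.elim (kfile B i [] (pre ++ rest) (scan x (bitsToNat nL) pre rest fnd) f')
            (file xj' nL zj' [] [] [] [] []))
          (rest.length * (mbodyCost (pre.length + rest.length) nL.length cL.length + 2) + 1)
  | [], pre, fj, xj, zj, fnd, hf, hxj, hzj => by
    refine ⟨xj, zj, fj, hxj, hzj, hf, (Runs.loop_nil _ _ (by simp [kfile])).of_eq ?_ (by simp)⟩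
    simp [-Sum.elim_update_left, -Sum.elim_update_right, scan]
  | b :: rest, pre, fj, xj, zj, fnd, hf, hxj, hzj => by
    have hk : (Sum.elim (kfile B i (b :: rest) pre fnd fj) (file xj nL zj [] [] [] [] []) : Regs R) (Sum.inl K.Y) =
        b :: rest := by simp [kfile]
    obtain ⟨xj₁, zj₁, f₁, hxj₁, hzj₁, hf₁, hbody⟩ := runs_mbody b B x i rest pre fj xj zj nL xb cL fnd hE hM hXB hI hT
      hC hN hn hxb hxbl hi hf hxj hzj
    have hbody' : Runs (mbody b)
        (Function.update (Sum.elim (kfile B i (b :: rest) pre fnd fj) (file xj nL zj [] [] [] [] []) : Regs R)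
          (Sum.inl K.Y) rest)
        (Sum.elim (kfile B i rest (pre ++ [b]) (step x (bitsToNat nL) pre b fnd) f₁) (file xj₁ nL zj₁ [] [] [] [] []))
        (mbodyCost (pre.length + (b :: rest).length) nL.length cL.length) := by
      rw [Sum.update_elim_inl, update_kfile_Y]
      exact hbody.mono (mbodyCost_mono (by simp) _ _)
    obtain ⟨xj₂, zj₂, f₂, hxj₂, hzj₂, hf₂, hrest⟩ := runs_mloop B x i nL xb cL hE hM hXB hI hT hC hN hn hxb hxbl hi
      rest (pre ++ [b]) f₁ xj₁ zj₁ (step x (bitsToNat nL) pre b fnd) hf₁ hxj₁ hzj₁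
    rw [List.append_assoc, List.singleton_append, ← scan_cons, List.length_append, List.length_singleton,
      show pre.length + 1 + rest.length = pre.length + (b :: rest).length by simp; omega] at hrest
    refine ⟨xj₂, zj₂, f₂, hxj₂, hzj₂, hf₂, ?_⟩
    cases b
    · exact (Runs.loop_false hk hbody' hrest).of_eq rfl (by simp; ring_nf; omega)
    · exact (Runs.loop_true hk hbody' hrest).of_eq rfl (by simp; ring_nf; omega)

/-! ### The kernel: place the operands, reduce the base, scan, emit -/

/-- The kernel, run on a valid query: move `n` into the bank and `i`, `y` into place, reduce the
base `x` modulo `n` (`modMul` by the multiplier `x` with multiplicand `1`), run the main loop,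
and emit `false` if no bit was emitted. [folklore] -/
def kernel : Com R :=
  pour (.inl .t3) (.inr .y) ;;
  (pour (.inl .t2) (.inl .I) ;;
  (pour (.inl .t1) (.inl .Y) ;;
  (Com.push (.inr .z) true ;;
  (modMul K.a3 ;;
  (move (.inr .x) (.inl .XB) (.inr .s) ;;
  (mloop ;;
  ifFlag (.inl .DONE) skip (Com.push (.inl .OUT) false)))))))

/-- **The whole program**: parse; on a valid query run the kernel, otherwise emit `false`.
[folklore] -/
def prog : Com R := parse ;; ifFlag (.inl .m2) kernel (Com.push (.inl .OUT) false)

/-- Cost of the kernel in terms of the input length `s` (all components are at most `s` long).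
[folklore] -/
def kernelCost (s : ℕ) : ℕ := s * (mbodyCost s s s + 2) + s * (141 * s + 163) + 15 * s + 12

/-- A valid query has a modulus numeral of value `> 1`. [folklore] -/
theorem one_lt_of_valid {z : List Bool} (hv : valid z = true) : 1 < bitsToNat (qb z) := by
  simp only [valid, Bool.and_eq_true, canonTop_reverse, decide_eq_true_eq] at hv
  exact (one_lt_bitsToNat_iff hv.1.1.1.2).2 hv.1.2

/-- The cost bookkeeping of the kernel. [folklore] -/
theorem kernel_cost_bound {s y a b c xb P1 : ℕ} (hy : y ≤ s) (ha : a ≤ s) (hb : b ≤ s) (hc : c ≤ s)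
    (hxb : xb ≤ s) (hP1 : P1 = y * (mbodyCost y b c + 2) + 1) (e : ℕ) (he : e ≤ 4) :
    3 * b + 1 + (3 * c + 1 + (3 * y + 1 + (1 + (a * (141 * b + 50 * [true].length + 113) + 1 +
      (6 * xb + 2 + (P1 + e)))))) ≤ kernelCost s := by
  rw [kernelCost, hP1]
  have hm : mbodyCost y b c + 2 ≤ mbodyCost s s s + 2 := Nat.add_le_add_right (mbodyCost_mono3 hy hb hc) 2
  have hp1 := Nat.mul_le_mul hy hm
  have hp2 : a * (141 * b + 50 * [true].length + 113) ≤ s * (141 * s + 163) :=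
    Nat.mul_le_mul ha (by simp; omega)
  generalize y * (mbodyCost y b c + 2) = Q1 at hp1 ⊢
  generalize s * (mbodyCost s s s + 2) = Q2 at hp1 ⊢
  generalize a * (141 * b + 50 * [true].length + 113) = Q3 at hp2 ⊢
  generalize s * (141 * s + 163) = Q4 at hp2 ⊢
  omega

/-- **Simulation of the kernel** on a valid query: it emits bit `i` of `orderFromPrefix x n y`.
[folklore] -/
theorem runs_kernel (z : List Bool) (hv : valid z = true) :
    ∃ Rf : Regs R, Runs kernel (Sum.elim (mk (parsed z)) bank0) Rf (kernelCost z.length) ∧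
      Rf (.inl .OUT) = [(orderFromPrefix (bitsToNat (qa z)) (bitsToNat (qb z)) (qy z)).testBit (bitsToNat (qc z))] := by
  have hn := one_lt_of_valid hv
  have hnl : 1 ≤ (qb z).length := length_pos_of_one_lt hn
  have h0 : bitsToNat ([] : List Bool) < bitsToNat (qb z) := by simp; omega
  have h1lt : bitsToNat [true] < bitsToNat (qb z) := by simpa using hn
  -- sizes
  have hw : (qw z).length ≤ z.length := length_boolUnpair_fst_le z
  have hy : (qy z).length ≤ z.length := length_boolUnpair_snd_le z
  have hab : (qab z).length ≤ z.length := (length_boolUnpair_fst_le _).trans hw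
  have hc : (qc z).length ≤ z.length := (length_boolUnpair_snd_le _).trans hw
  have ha : (qa z).length ≤ z.length := (length_boolUnpair_fst_le _).trans hab
  have hb : (qb z).length ≤ z.length := (length_boolUnpair_snd_le _).trans hab
  -- place the operands
  have h1 : Runs (pour (.inl .t3) (.inr .y) : Com R) (Sum.elim (mk (parsed z)) bank0)
      (Sum.elim (mk ((.t3, []) :: parsed z)) (file [] (qb z) [] [] [] [] [] [])) (3 * (qb z).length + 1) :=
    (runs_pour (by decide) _).of_eq (by simp [-Sum.elim_update_left, -Sum.elim_update_right]) (by simp)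
  have h2 : Runs (pour (.inl .t2) (.inl .I) : Com R) (Sum.elim (mk ((.t3, []) :: parsed z)) (file [] (qb z) [] [] [] [] [] []))
      (Sum.elim (mk ((.I, qc z) :: (.t2, []) :: (.t3, []) :: parsed z)) (file [] (qb z) [] [] [] [] [] []))
      (3 * (qc z).length + 1) :=
    (runs_pour (by decide) _).of_eq (by simp [-Sum.elim_update_left, -Sum.elim_update_right]) (by simp)
  have h3 : Runs (pour (.inl .t1) (.inl .Y) : Com R)
      (Sum.elim (mk ((.I, qc z) :: (.t2, []) :: (.t3, []) :: parsed z)) (file [] (qb z) [] [] [] [] [] []))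
      (Sum.elim (mk ((.Y, qy z) :: (.t1, []) :: (.I, qc z) :: (.t2, []) :: (.t3, []) :: parsed z))
        (file [] (qb z) [] [] [] [] [] [])) (3 * (qy z).length + 1) :=
    (runs_pour (by decide) _).of_eq (by simp [-Sum.elim_update_left, -Sum.elim_update_right]) (by simp)
  set O1 : List (K × List Bool) := (.Y, qy z) :: (.t1, []) :: (.I, qc z) :: (.t2, []) :: (.t3, []) :: parsed z
    with hO1
  have h4 : Runs (Com.push (.inr .z) true : Com R) (Sum.elim (mk O1) (file [] (qb z) [] [] [] [] [] []))
      (Sum.elim (mk O1) (file [] (qb z) [true] [] [] [] [] [])) 1 := Runs.push' (by simp)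
  -- reduce the base
  have h5 := runs_modMul (κ := K) K.a3 (qa z).reverse (mk O1) [] (qb z) [true] (by simp [hO1]) h0 h1lt (by simp)
  rw [update_mk, List.length_reverse] at h5
  set xb := modMulRes (qa z).reverse [] (qb z) [true] with hxbdef
  have hxbv : bitsToNat xb = bitsToNat (qa z) % bitsToNat (qb z) := by
    rw [hxbdef, bitsToNat_modMulRes_nil _ _ _ (by omega) h1lt]; simp
  have hxbl : xb.length ≤ (qb z).length := (modMulRes_lt_and_length _ _ _ _ h0 h1lt (by simp)).2
  have h6 : Runs (move (.inr .x) (.inl .XB) (.inr .s) : Com R)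
      (Sum.elim (mk ((.a3, []) :: O1)) (file xb (qb z) [true] [] [] [] [] []))
      (Sum.elim (mk ((.XB, xb) :: (.a3, []) :: O1)) (file [] (qb z) [true] [] [] [] [] [])) (6 * xb.length + 2) :=
    (runs_move (by decide) (by decide) (by decide) _ rfl).of_eq
      (by simp [-Sum.elim_update_left, -Sum.elim_update_right, hO1]) (by simp)
  set B : Regs K := mk ((.XB, xb) :: (.a3, []) :: O1) with hB
  have hK : B = kfile B (bitsToNat (qc z)) (qy z) [] none (B .fl) :=
    eq_kfile _ _ _ _ _ _ _ (by simp [hB, hO1]) (by simp [hB, hO1]) rfl (by simp [hB, hO1, fdReg])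
      (by simp [hB, hO1, dnReg]) (by simp [hB, hO1, outReg]) (fun _ _ _ _ _ _ _ => rfl)
  have hfl : (B .fl).length ≤ 1 := by simp only [hB, hO1]; simp; exact length_flag_le _
  -- the main loop
  obtain ⟨xj', zj', f', -, -, -, h7⟩ := runs_mloop B (bitsToNat (qa z)) (bitsToNat (qc z)) (qb z) xb (qc z)
    (by simp [hB, hO1]) (by simp [hB, hO1]) (by simp [hB]) (by simp [hB, hO1]) (by simp [hB, hO1])
    (by simp [hB, hO1]) (by simp [hB, hO1]) hn hxbv hxbl rfl (qy z) [] (B .fl) [] [true] none hfl (by simp)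
    (by simpa using hnl)
  rw [← hK] at h7
  simp only [List.nil_append, List.length_nil, zero_add] at h7
  set fnd := scan (bitsToNat (qa z)) (bitsToNat (qb z)) [] (qy z) none with hfnd
  set Tf := kfile B (bitsToNat (qc z)) [] (qy z) fnd f' with hTf
  -- emit
  have hout : orderFromPrefix (bitsToNat (qa z)) (bitsToNat (qb z)) (qy z) = (fnd.map bitsToNat).getD 0 := by
    rw [hfnd]; exact orderFromPrefix_eq_scan _ _ _
  by_cases hd : Tf .DONE = [true]
  · have h8 : Runs (ifFlag (.inl .DONE) skip (Com.push (.inl .OUT) false) : Com R)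
        (Sum.elim Tf (file xj' (qb z) zj' [] [] [] [] [])) (Sum.elim Tf (file xj' (qb z) zj' [] [] [] [] [])) (0 + 3) :=
      runs_ifFlag_true _ (by simp [hd]) (Runs.skip _)
    refine ⟨_, (h1.seq (h2.seq (h3.seq (h4.seq (h5.seq (h6.seq (h7.seq h8))))))).of_eq rfl ?_, ?_⟩
    · exact kernel_cost_bound hy ha hb hc (hxbl.trans hb) rfl _ (by omega)
    · -- the recorded bit
      simp only [Sum.elim_inl]
      rcases hf : fnd with _ | ⟨cand⟩
      · rw [hTf, hf] at hd; simp [kfile, dnReg] at hd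
      · rw [hTf, hf] at hd ⊢
        simp only [kfile, dnReg, Function.update_self, Function.update_of_ne, ne_eq, reduceCtorEq,
          not_false_eq_true, outReg] at hd ⊢
        have hi : bitsToNat (qc z) < cand.length := by
          by_contra h; simp [h] at hd
        rw [hout, hf]
        simp [hi, testBit_bitsToNat]
  · have hTD : Tf .DONE = dnReg (bitsToNat (qc z)) fnd := by simp [hTf, kfile]
    have hd' : Tf .DONE = [] := by
      rw [hTD] at hd ⊢
      rcases hf : fnd with _ | ⟨cand⟩
      · simp [dnReg]
      · rw [hf] at hd
        by_cases hi : bitsToNat (qc z) < cand.length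
        · exact absurd (by simp [dnReg, hi]) hd
        · simp [dnReg, hi]
    have hTO : Tf .OUT = [] := by
      have : Tf .OUT = outReg (bitsToNat (qc z)) fnd := by simp [hTf, kfile]
      rw [this]
      rw [hTD] at hd
      rcases hf : fnd with _ | ⟨cand⟩
      · simp [outReg]
      · rw [hf] at hd
        by_cases hi : bitsToNat (qc z) < cand.length
        · exact absurd (by simp [dnReg, hi]) hd
        · simp [outReg, hi]
    have h8 : Runs (ifFlag (.inl .DONE) skip (Com.push (.inl .OUT) false) : Com R)
        (Sum.elim Tf (file xj' (qb z) zj' [] [] [] [] []))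
        (Sum.elim (Function.update Tf .OUT [false]) (file xj' (qb z) zj' [] [] [] [] [])) (1 + 3) :=
      runs_ifFlag_false _ (by simp [hd']) (Runs.push' (by
        simp [-Sum.elim_update_left, -Sum.elim_update_right, hTO]))
    refine ⟨_, (h1.seq (h2.seq (h3.seq (h4.seq (h5.seq (h6.seq (h7.seq h8))))))).of_eq rfl ?_, ?_⟩
    · exact kernel_cost_bound hy ha hb hc (hxbl.trans hb) rfl _ (by omega)
    · simp only [Sum.elim_inl, Function.update_self]
      rw [hout]
      rw [hTD] at hd
      rcases hf : fnd with _ | ⟨cand⟩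
      · simp
      · rw [hf] at hd
        by_cases hi : bitsToNat (qc z) < cand.length
        · exact absurd (by simp [dnReg, hi]) hd
        · simp only [Option.map_some, Option.getD_some, testBit_bitsToNat]
          rw [List.getD_eq_default _ _ (not_lt.mp hi)]


/-! ### The program computes `ordPost` in polynomial time -/

/-- **Functional correctness and running time of the program**: on every input `z` it leaves
`ordPost z` in `OUT` within `27|z| + 88 + kernelCost |z|` steps. [folklore] -/
theorem runs_prog (z : List Bool) :
    ∃ Rf : Regs R, Runs prog (Regs.init (Sum.inl K.inp) z) Rf (27 * z.length + 88 + kernelCost z.length) ∧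
      Rf (.inl .OUT) = ordPost z := by
  rw [init_eq, ordPost_eq]
  have hp := runs_parse z
  have hm2 : mk (parsed z) K.m2 = flag (valid z) := by simp [valid]
  by_cases hv : valid z = true
  · obtain ⟨Rf, hk, hout⟩ := runs_kernel z hv
    refine ⟨Rf, (hp.seq (runs_ifFlag_true _ (by rw [Sum.elim_inl, hm2, hv]) hk)).of_eq rfl (by omega), ?_⟩
    rw [hout, if_pos hv]
  · have hvf : valid z = false := by rwa [Bool.not_eq_true] at hv
    refine ⟨_, (hp.seq (runs_ifFlag_false _ (by rw [Sum.elim_inl, hm2, hvf])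
      (Runs.push' (k := (Sum.inl K.OUT : R)) (b := false) rfl))).of_eq rfl (by omega), ?_⟩
    rw [if_neg hv]
    simp

/-- The step-bound polynomial of the program. [folklore] -/
noncomputable def costPoly : Polynomial ℕ :=
  27 * Polynomial.X + 88 +
    (Polynomial.X * ((Polynomial.X + 2) * ((382 * Polynomial.X ^ 2 + 262 * Polynomial.X + 13) + 2) +
        (Polynomial.X + 2) * (16 * Polynomial.X + 40) + 23 * Polynomial.X + 10 * Polynomial.X +
        12 * Polynomial.X + 70 + 2) +
      Polynomial.X * (141 * Polynomial.X + 163) + 15 * Polynomial.X + 12)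

/-- The step-bound polynomial evaluates to the step bound. [folklore] -/
theorem costPoly_eval (s : ℕ) : costPoly.eval s = 27 * s + 88 + kernelCost s := by
  simp [costPoly, kernelCost, mbodyCost, modExpStepCost]

/-- **Shor's classical post-processor is polynomial time: the programming fact `ordPost_mem_FP`
of `ShorAssembly.lean`, discharged.** The structured stack program `prog` (parse the query
`⟨⟨⟨x, n⟩, i⟩, y⟩` with three pair decoders and validity checks; reduce `x` modulo `n`; for the
prefixes of `y` by increasing length run CLRS's MODULAR-EXPONENTIATION on the canonical candidate
and test `x ^ c ≡ 1 (mod n)`; on the first success read bit `i` of the candidate by a counter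
walk) computes `ordPost` (`runs_prog`, via `ordPost_eq`, `orderFromPrefix_eq_scan`) within the
polynomial `costPoly` (degree 4), so `ordPost ∈ FP` by `Com.mem_FP` (`StackPrograms.lean`).
[cite: AroraBarak2009, §1.3 (polynomial time on Turing machines; robustness)] -/
theorem _root_.Literature.Computability.Cryptography.ordPost_mem_FP_holds : ordPost_mem_FP :=
  Com.mem_FP prog (Sum.inl K.inp) (Sum.inl K.OUT) costPoly ordPost fun z => by
    obtain ⟨Rf, h, hout⟩ := runs_prog z
    exact ⟨Rf, Or.inl (by rw [costPoly_eval]; exact h), hout⟩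

end OrdPost

end Literature.Computability.Cryptography
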